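import Literature.Analysis.FluidPDE.LeraySchemeConvergence
import Literature.Analysis.FluidPDE.LeraySchemePressure
import Literature.Analysis.FluidPDE.NormalisedPressureDifferenceLp
import Literature.Analysis.FluidPDE.LeraySchemePressureBounds
import Literature.Analysis.FluidPDE.ClassicalDriftSuitable
import Literature.Analysis.FluidPDE.ClassicalSuitable
import Literature.Analysis.FluidPDE.SuitableWeakStability
import Literature.Analysis.FluidPDE.SuitableWeakExhaustion
import Literature.Analysis.FluidPDE.WeakGradientSubseqLimit
import Literature.Analysis.FluidPDE.LocalEnergySolutionsOn
import Literature.Analysis.FluidPDE.LocalLerayExistence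
import HarnessLib

/-!
# Leray's weak solutions are suitable: local energy solutions for finite-energy data

Analysis/FluidPDE theorem file (no definitions, no named facts). Last file of the proof that
**Leray's weak solutions are suitable** (Caffarelli–Kohn–Nirenberg 1982, Appendix: "the weak
solutions constructed by Leray are suitable"; Lemarié-Rieusset 2002/2016): the global Leray–Hopf
weak solution obtained as the limit of Leray's regularised scheme
`∂ₜu − νΔu + ((J_ε u)·∇)u + ∇p = 0` (`exists_lerayScheme_with_pressure`,
`IsLerayRegularisedScheme.exists_subseq_limit_package`, `LeraySchemeConvergence.lean`) satisfies,
together with the Riesz-transform pressure `p(t) = p̃[u(t)]`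
(`exists_measurable_limit_pressure`, `LeraySchemePressureBounds.lean`), the local energy
inequality, and is a **local energy solution** in the sense of Seregin 2014, App. B, Def. B.1 /
Kang–Miura–Tsai (`IsLocalEnergySolutionOn`) on every strip `(0, T) × ℝ³`.

The passage to the limit is the one of CKN's appendix, organised as follows.

* `setIntegral_weak_identity_regularised`, `setIntegral_local_energy_regularised` — the weak
  identity and the local energy **equality** of the classical regularised solutions
  `(J U n, U n, P n)` on a region of the strip (`ClassicalDriftSuitable.lean`).
* `IsLerayRegularisedScheme.isSuitableWeakSolutionOn_limit_cylinder` — on a cylinder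
  `(0, T) × B(0, R)`: `U n → u` and `J U n → u` in `L³` (`LeraySchemeConvergence.lean`),
  `P n → p` in `L^{3/2}` (`LeraySchemePressureBounds.lean`), `∇U_{σ n} ⇀ G` weakly in `L²` with
  `G` a weak spatial gradient of `u` (`exists_subseq_weakGradient_weakLimit`); the distributional
  equations pass to the limit term by term, and the local energy equality becomes the local
  energy inequality by lower semicontinuity of `∫∫ |∇U|² φ`.
* `IsLerayRegularisedScheme.isSuitableWeakSolutionOn_limit_slab` — the strip by exhaustion
  (`IsSuitableWeakSolutionOn.of_exhaustion`).
* `IsLerayRegularisedScheme.exists_hasWeakSpatialGradientOn_cylinder_le` — the weak gradient on a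
  cylinder with the **global** dissipation bound `∫∫ |∇u|² ≤ ½‖u₀‖₂²/ν`.
* `IsLerayRegularisedScheme.isLocalEnergySolutionOn_limit` — the remaining clauses of Def. B.1:
  `p ∈ L^{3/2}((0,T) × ℝ³)`, `sup_t sup_{x₀} ∫_{B(x₀,1)} |u(t)|² ≤ ‖u₀‖₂²`,
  `sup_{x₀} ∫₀ᵀ∫_{B(x₀,1)} |∇u|² ≤ ½‖u₀‖₂²/ν`, weak `L²` continuity on `[0, T]`, strong attainment
  of the datum, and decay at spatial infinity (tails of the finite space–time energy).
* `exists_isGlobalLerayHopf_and_isLocalEnergySolutionOn` — **assembly**: for `ν > 0` and every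
  weakly divergence-free `u₀ ∈ L²(ℝ³)` there are `u`, `p` with `u` a global Leray–Hopf weak
  solution, `p = p̃[u]` a.e. (jointly measurable, in `L^{3/2}` of every strip), and `(u, p)` a local
  energy solution on `(0, T)` for every `T > 0`.

This is the finite-energy existence input of the extension step for local energy solutions with
`E²` data (`localEnergySolution_extension_of_memE2`, `LocalEnergyExtension.lean`;
Lemarié-Rieusset 2016, Thm. 14.8, proof, Step 2 = Seregin 2014, App. B §B.5).

## References

* L. Caffarelli, R. Kohn, L. Nirenberg, *Partial regularity of suitable weak solutions of the
  Navier–Stokes equations*, Comm. Pure Appl. Math. 35 (1982), Appendix. [CaffarelliKohnNirenberg1982]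
* J. Leray, *Sur le mouvement d'un liquide visqueux emplissant l'espace*, Acta Math. 63 (1934),
  Ch. V §§26–31. [Leray1934]
* G. Seregin, *Lecture Notes on Regularity Theory for the Navier–Stokes Equations*, World
  Scientific 2014, App. B, Def. B.1, §B.5. [Seregin2014]
* P. G. Lemarié-Rieusset, *The Navier–Stokes Problem in the 21st Century*, CRC 2016, Thm. 12.2,
  Prop. 14.3, Thm. 14.8. [LemarieRieusset2016]
-/

noncomputable section

open MeasureTheory TopologicalSpace Set Function Filter Topology Real ContinuousLinearMap Metric
open scoped InnerProductSpace RealInnerProductSpace ENNReal NNReal Laplacian Convolution ContDiff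

namespace Literature.Analysis.FluidPDE

/-- `‖a + b‖ₑ³ ≤ 4(‖a‖ₑ³ + ‖b‖ₑ³)` (real exponent). [folklore] -/
private theorem enorm_add_rpow_three_le₁ {F : Type*} [NormedAddCommGroup F] (a b : F) :
    ‖a + b‖ₑ ^ (3 : ℝ) ≤ 4 * (‖a‖ₑ ^ (3 : ℝ) + ‖b‖ₑ ^ (3 : ℝ)) := by
  have h := (ENNReal.rpow_le_rpow (enorm_add_le a b) (by norm_num : (0 : ℝ) ≤ 3)).trans
    (ENNReal.rpow_add_le_mul_rpow_add_rpow ‖a‖ₑ ‖b‖ₑ (by norm_num : (1 : ℝ) ≤ 3))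
  have e : (2 : ℝ≥0∞) ^ ((3 : ℝ) - 1) = 4 := by
    rw [show (3 : ℝ) - 1 = 2 by norm_num, ENNReal.rpow_two]; norm_num
  rwa [e] at h

section Approximants

variable {ν : ℝ} {u₀ : EuclideanSpace ℝ (Fin 3) → EuclideanSpace ℝ (Fin 3)}
  {φ : ℕ → ContDiffBump (0 : EuclideanSpace ℝ (Fin 3))}
  {U : ℕ → ℝ → EuclideanSpace ℝ (Fin 3) → EuclideanSpace ℝ (Fin 3)}
  {P : ℕ → ℝ → EuclideanSpace ℝ (Fin 3) → ℝ}

/-- **The regularised solutions on the open strip `(0, T)`**: `U n` is jointly `C²`, the drift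
`J_{φ n} U n` and the pressure `P n` jointly `C¹` on `(0, T) × ℝ³`, the momentum equation holds
with the two-sided time derivative, and both fields are divergence free. [folklore] -/
theorem drift_regularity_on_Ioo
    (hP : ∀ n T, 0 < T →
      IsClassicalDriftNSSolutionOn (Icc 0 T) ν (fun t => mollify (φ n) (U n t)) (U n) (P n))
    (n : ℕ) {T : ℝ} (hT : 0 < T) :
    ContDiffOn ℝ 2 (uncurry (U n)) (Ioo (0 : ℝ) T ×ˢ univ) ∧
      ContDiffOn ℝ 1 (uncurry fun t => mollify (φ n) (U n t)) (Ioo (0 : ℝ) T ×ˢ univ) ∧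
      ContDiffOn ℝ 1 (uncurry (P n)) (Ioo (0 : ℝ) T ×ˢ univ) ∧
      (∀ t ∈ Ioo (0 : ℝ) T, ∀ x, timeDeriv (U n) t x + convect (mollify (φ n) (U n t)) (U n t) x =
        ν • (Δ (U n t)) x - gradient (P n t) x + (0 : ℝ → EuclideanSpace ℝ (Fin 3) → EuclideanSpace ℝ (Fin 3)) t x) ∧
      (∀ t ∈ Ioo (0 : ℝ) T, VectorCalculus.IsDivFree (mollify (φ n) (U n t))) ∧
      (∀ t ∈ Ioo (0 : ℝ) T, VectorCalculus.IsDivFree (U n t)) := by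
  have hsol := (hP n T hT).mono Ioo_subset_Icc_self isOpen_Ioo.uniqueDiffOn
  refine ⟨hsol.smooth_velocity.of_le (by norm_cast),
    hsol.smooth_drift.of_le (by norm_cast),
    hsol.smooth_pressure.of_le (by norm_cast), fun t ht x => ?_,
    fun t ht => hsol.divFree_drift t ht, fun t ht => hsol.divFree t ht⟩
  rw [hsol.momentum_timeDeriv isOpen_Ioo ht x, Pi.zero_apply, Pi.zero_apply, add_zero]

/-- A function continuous on the open strip `(0, T) × ℝ³` and vanishing off a compact subset of
an open region `Q` of the strip is integrable on `Q`, and its iterated integral is its integral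
over `Q`. [folklore] -/
theorem integrableOn_and_integral_integral_eq_of_continuousOn {F : Type*} [NormedAddCommGroup F]
    [NormedSpace ℝ F] {T : ℝ} {Q : Opens (ℝ × EuclideanSpace ℝ (Fin 3))}
    (hQ : (Q : Set (ℝ × EuclideanSpace ℝ (Fin 3))) ⊆ Ioo (0 : ℝ) T ×ˢ univ)
    {K : Set (ℝ × EuclideanSpace ℝ (Fin 3))} (hK : IsCompact K) (hKQ : K ⊆ (Q : Set (ℝ × EuclideanSpace ℝ (Fin 3))))
    {H : ℝ × EuclideanSpace ℝ (Fin 3) → F}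
    (hH : ContinuousOn H (Ioo (0 : ℝ) T ×ˢ univ)) (h0 : ∀ z ∉ K, H z = 0) :
    IntegrableOn H (Q : Set (ℝ × EuclideanSpace ℝ (Fin 3))) volume ∧
      ∫ t, ∫ x, H (t, x) = ∫ z in (Q : Set (ℝ × EuclideanSpace ℝ (Fin 3))), H z := by
  have hc : Continuous H :=
    continuous_of_continuousOn_of_eq_zero (isOpen_Ioo.prod isOpen_univ) hK.isClosed (hKQ.trans hQ) hH h0
  have hint : Integrable H (volume : Measure (ℝ × EuclideanSpace ℝ (Fin 3))) :=
    hc.integrable_of_hasCompactSupport (HasCompactSupport.intro hK h0)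
  refine ⟨hint.integrableOn, ?_⟩
  exact integral_integral_eq_setIntegral hint.integrableOn fun z hz => h0 z fun h => hz (hKQ h)

/-- **The weak identity of the regularised solutions on a region of the strip** (set-integral
form, no force): for every vector test field `ψ` on an open `Q ⊆ (0, T) × ℝ³`,
`∫_Q (⟪U n, ∂ₜψ⟫ + ⟪U n, ((J U n)·∇)ψ⟫ + ν⟪U n, Δψ⟫ + P n div ψ) = 0`. [cite: Leray1934, Ch. V §26 (5.1)] -/
theorem setIntegral_weak_identity_regularised
    (hP : ∀ n T, 0 < T →
      IsClassicalDriftNSSolutionOn (Icc 0 T) ν (fun t => mollify (φ n) (U n t)) (U n) (P n))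
    (n : ℕ) {T : ℝ} (hT : 0 < T) {Q : Opens (ℝ × EuclideanSpace ℝ (Fin 3))}
    (hQ : (Q : Set (ℝ × EuclideanSpace ℝ (Fin 3))) ⊆ Ioo (0 : ℝ) T ×ˢ univ)
    {ψ : ℝ → EuclideanSpace ℝ (Fin 3) → EuclideanSpace ℝ (Fin 3)} (hψ : IsSpaceTimeTestOn Q ψ) :
    ∫ z in (Q : Set (ℝ × EuclideanSpace ℝ (Fin 3))), (⟪U n z.1 z.2, timeDeriv ψ z.1 z.2⟫ +
        ⟪U n z.1 z.2, convect (mollify (φ n) (U n z.1)) (ψ z.1) z.2⟫ +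
        ν * ⟪U n z.1 z.2, (Δ (ψ z.1)) z.2⟫ +
        P n z.1 z.2 * VectorCalculus.divergence (ψ z.1) z.2) = 0 := by
  obtain ⟨hu, hb, hp, hmom, hdivb, -⟩ := drift_regularity_on_Ioo hP n hT
  have h := setIntegral_drift_weak_identity_of_contDiffOn (f := (0 : ℝ → EuclideanSpace ℝ (Fin 3) → EuclideanSpace ℝ (Fin 3)))
    isOpen_Ioo hQ hu hb hp continuousOn_const hmom hdivb hψ
  rw [← h]
  refine integral_congr_ae (Eventually.of_forall fun z => ?_)
  simp only [Pi.zero_apply, inner_zero_left, add_zero]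

/-- **Leray's local energy equality of the regularised solutions on a region of the strip**
(set-integral form, no force): for every scalar test function `φ'` on an open `Q ⊆ (0, T) × ℝ³`,
`|∇U n|² φ'` is integrable on `Q` and
`2ν ∫_Q |∇U n|² φ' = ∫_Q (|U n|²(∂ₜφ' + νΔφ') + |U n|² ⟪J U n, ∇φ'⟫ + 2 P n ⟪U n, ∇φ'⟫)`.
[cite: Leray1934, Ch. V §27 (5.3)] -/
theorem setIntegral_local_energy_regularised
    (hP : ∀ n T, 0 < T →
      IsClassicalDriftNSSolutionOn (Icc 0 T) ν (fun t => mollify (φ n) (U n t)) (U n) (P n))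
    (n : ℕ) {T : ℝ} (hT : 0 < T) {Q : Opens (ℝ × EuclideanSpace ℝ (Fin 3))}
    (hQ : (Q : Set (ℝ × EuclideanSpace ℝ (Fin 3))) ⊆ Ioo (0 : ℝ) T ×ˢ univ)
    {θ : ℝ → EuclideanSpace ℝ (Fin 3) → ℝ} (hθ : IsSpaceTimeTestOn Q θ) :
    IntegrableOn (fun z : ℝ × EuclideanSpace ℝ (Fin 3) =>
        frobeniusNormSq (fderiv ℝ (U n z.1) z.2) * θ z.1 z.2) (Q : Set (ℝ × EuclideanSpace ℝ (Fin 3))) volume ∧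
      2 * ν * ∫ z in (Q : Set (ℝ × EuclideanSpace ℝ (Fin 3))), frobeniusNormSq (fderiv ℝ (U n z.1) z.2) * θ z.1 z.2 =
        ∫ z in (Q : Set (ℝ × EuclideanSpace ℝ (Fin 3))),
          (‖U n z.1 z.2‖ ^ 2 * (timeDeriv θ z.1 z.2 + ν * (Δ (θ z.1)) z.2) +
            ‖U n z.1 z.2‖ ^ 2 * ⟪mollify (φ n) (U n z.1) z.2, gradient (θ z.1) z.2⟫ +
            2 * P n z.1 z.2 * ⟪U n z.1 z.2, gradient (θ z.1) z.2⟫) := by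
  obtain ⟨hu, hb, hp, hmom, hdivb, hdivu⟩ := drift_regularity_on_Ioo hP n hT
  have h := drift_local_energy_eq_of_contDiffOn (f := (0 : ℝ → EuclideanSpace ℝ (Fin 3) → EuclideanSpace ℝ (Fin 3)))
    isOpen_Ioo hQ hu hb hp continuousOn_const hmom hdivb hdivu hθ
  -- the compact support and the vanishing of the weights off it
  set K : Set (ℝ × EuclideanSpace ℝ (Fin 3)) := tsupport (uncurry θ) with hK_def
  have hK : IsCompact K := hθ.hasCompactSupport
  have hKQ : K ⊆ (Q : Set (ℝ × EuclideanSpace ℝ (Fin 3))) := hθ.tsupport_subset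
  have hθ0 : ∀ z ∉ K, θ z.1 z.2 = 0 := fun z hz =>
    (image_eq_zero_of_notMem_tsupport hz : uncurry θ z = 0)
  have hgθ0 : ∀ z ∉ K, gradient (θ z.1) z.2 = 0 := fun z hz =>
    gradient_eq_zero_of_notMem_tsupport (notMem_tsupport_slice_of_notMem hz)
  have hΔθ0 : ∀ z ∉ K, (Δ (θ z.1)) z.2 = 0 := fun z hz =>
    laplacian_eq_zero_of_notMem_tsupport (notMem_tsupport_slice_of_notMem hz)
  have hTθ0 : ∀ z ∉ K, timeDeriv θ z.1 z.2 = 0 := fun z hz =>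
    timeDeriv_eq_zero_off_tsupport hz
  -- continuity on the open strip
  have cu : ContinuousOn (fun z : ℝ × EuclideanSpace ℝ (Fin 3) => U n z.1 z.2) (Ioo (0 : ℝ) T ×ˢ univ) :=
    hu.continuousOn
  have cb : ContinuousOn (fun z : ℝ × EuclideanSpace ℝ (Fin 3) => mollify (φ n) (U n z.1) z.2)
      (Ioo (0 : ℝ) T ×ˢ univ) := hb.continuousOn
  have cp : ContinuousOn (fun z : ℝ × EuclideanSpace ℝ (Fin 3) => P n z.1 z.2) (Ioo (0 : ℝ) T ×ˢ univ) :=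
    hp.continuousOn
  have cDu : ContinuousOn (fun z : ℝ × EuclideanSpace ℝ (Fin 3) => fderiv ℝ (U n z.1) z.2)
      (Ioo (0 : ℝ) T ×ˢ univ) :=
    continuousOn_fderiv_slice_of_contDiffOn (hu.of_le one_le_two) isOpen_Ioo.uniqueDiffOn
  have cθ : Continuous fun z : ℝ × EuclideanSpace ℝ (Fin 3) => θ z.1 z.2 := hθ.contDiff.continuous
  have cTθ : Continuous fun z : ℝ × EuclideanSpace ℝ (Fin 3) => timeDeriv θ z.1 z.2 := hθ.continuous_timeDeriv
  have cgθ : Continuous fun z : ℝ × EuclideanSpace ℝ (Fin 3) => gradient (θ z.1) z.2 :=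
    hθ.continuous_slice_gradient
  have cΔθ : Continuous fun z : ℝ × EuclideanSpace ℝ (Fin 3) => (Δ (θ z.1)) z.2 := hθ.continuous_laplacian_slice
  -- the two integrands
  have hL := integrableOn_and_integral_integral_eq_of_continuousOn hQ hK hKQ
    (H := fun z : ℝ × EuclideanSpace ℝ (Fin 3) => frobeniusNormSq (fderiv ℝ (U n z.1) z.2) * θ z.1 z.2)
    ((LerayHopfProofs.continuous_frobeniusNormSq.comp_continuousOn cDu).mul cθ.continuousOn)
    (fun z hz => by simp only [hθ0 z hz, mul_zero])
  have hR := integrableOn_and_integral_integral_eq_of_continuousOn hQ hK hKQ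
    (H := fun z : ℝ × EuclideanSpace ℝ (Fin 3) =>
      ‖U n z.1 z.2‖ ^ 2 * (timeDeriv θ z.1 z.2 + ν * (Δ (θ z.1)) z.2) +
        ‖U n z.1 z.2‖ ^ 2 * ⟪mollify (φ n) (U n z.1) z.2, gradient (θ z.1) z.2⟫ +
        2 * P n z.1 z.2 * ⟪U n z.1 z.2, gradient (θ z.1) z.2⟫ +
        2 * ⟪(0 : ℝ → EuclideanSpace ℝ (Fin 3) → EuclideanSpace ℝ (Fin 3)) z.1 z.2, U n z.1 z.2⟫ * θ z.1 z.2)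
    ((((cu.norm.pow 2).mul (cTθ.continuousOn.add (continuousOn_const.mul cΔθ.continuousOn))).add
      ((cu.norm.pow 2).mul (cb.inner cgθ.continuousOn))).add
      ((continuousOn_const.mul cp).mul (cu.inner cgθ.continuousOn)) |>.add
      ((continuousOn_const.mul (continuousOn_const.inner cu)).mul cθ.continuousOn))
    (fun z hz => by
      simp only [hθ0 z hz, hgθ0 z hz, hΔθ0 z hz, hTθ0 z hz]
      simp)
  refine ⟨hL.1, ?_⟩
  rw [← hL.2, h, hR.2]
  refine integral_congr_ae (Eventually.of_forall fun z => ?_)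
  simp only [Pi.zero_apply, inner_zero_left, mul_zero, zero_mul, add_zero]

end Approximants

section Limit

variable {ν : ℝ} {u₀ : EuclideanSpace ℝ (Fin 3) → EuclideanSpace ℝ (Fin 3)}
  {φ : ℕ → ContDiffBump (0 : EuclideanSpace ℝ (Fin 3))}
  {U : ℕ → ℝ → EuclideanSpace ℝ (Fin 3) → EuclideanSpace ℝ (Fin 3)}
  {P : ℕ → ℝ → EuclideanSpace ℝ (Fin 3) → ℝ}
  {u : ℝ → EuclideanSpace ℝ (Fin 3) → EuclideanSpace ℝ (Fin 3)}
  {p : ℝ → EuclideanSpace ℝ (Fin 3) → ℝ}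

/-- From `∫⁻ ‖f‖ₑ³ ≤ M < ∞` to `f ∈ L³` with `‖f‖₃ ≤ M^{1/3}`. [folklore] -/
theorem memLp_three_of_lintegral_le {X : Type*} [MeasurableSpace X] {μ : Measure X}
    {F : Type*} [NormedAddCommGroup F] {f : X → F} (hfm : AEStronglyMeasurable f μ) {M : ℝ≥0∞}
    (hM : M ≠ ⊤) (h : ∫⁻ x, ‖f x‖ₑ ^ (3 : ℝ) ∂μ ≤ M) :
    MemLp f 3 μ ∧ eLpNorm f 3 μ ≤ M ^ (1 / 3 : ℝ) := by
  have he : eLpNorm f 3 μ = (∫⁻ x, ‖f x‖ₑ ^ (3 : ℝ) ∂μ) ^ (1 / 3 : ℝ) := by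
    rw [eLpNorm_eq_lintegral_rpow_enorm_toReal (by norm_num) (by norm_num), ENNReal.toReal_ofNat]
  have hle : eLpNorm f 3 μ ≤ M ^ (1 / 3 : ℝ) := by rw [he]; exact ENNReal.rpow_le_rpow h (by norm_num)
  exact ⟨⟨hfm, hle.trans_lt (ENNReal.rpow_lt_top_of_nonneg (by norm_num) hM)⟩, hle⟩

/-- `‖f‖_{L³(μ)} → 0` from `∫⁻ ‖f‖ₑ³ dμ → 0`. [folklore] -/
theorem tendsto_eLpNorm_three_of_lintegral {X : Type*} [MeasurableSpace X] {μ : Measure X}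
    {F : Type*} [NormedAddCommGroup F] {f : ℕ → X → F}
    (h : Tendsto (fun k => ∫⁻ x, ‖f k x‖ₑ ^ (3 : ℝ) ∂μ) atTop (𝓝 0)) :
    Tendsto (fun k => eLpNorm (f k) 3 μ) atTop (𝓝 0) := by
  have h1 := ((ENNReal.continuous_rpow_const (y := (1 / 3 : ℝ))).tendsto 0).comp h
  rw [ENNReal.zero_rpow_of_pos (by norm_num)] at h1
  refine h1.congr fun k => ?_
  simp only [Function.comp_apply]
  rw [eLpNorm_eq_lintegral_rpow_enorm_toReal (by norm_num) (by norm_num), ENNReal.toReal_ofNat]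

/-- **Hölder for the product of norms, two codomains**: `‖|f| |g|‖_r ≤ ‖f‖_p ‖g‖_q` for a
Hölder triple. [folklore] -/
theorem eLpNorm_norm_mul_norm_le_holder₂ {α : Type*} {m : MeasurableSpace α} {μ : Measure α}
    {F G : Type*} [NormedAddCommGroup F] [NormedAddCommGroup G] {f : α → F} {g : α → G}
    (hf : AEStronglyMeasurable f μ) (hg : AEStronglyMeasurable g μ) {p q r : ℝ≥0∞} [ENNReal.HolderTriple p q r] :
    eLpNorm (fun x => ‖f x‖ * ‖g x‖) r μ ≤ eLpNorm f p μ * eLpNorm g q μ := by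
  have h := eLpNorm_le_eLpNorm_mul_eLpNorm'_of_norm hf hg (fun a b => ‖a‖ * ‖b‖) 1
    (Eventually.of_forall fun x => by
      rw [NNReal.coe_one, one_mul, Real.norm_eq_abs, abs_of_nonneg (by positivity)]) (p := p) (q := q) (r := r)
  simpa using h

/-- `|‖a‖² − ‖b‖²| ≤ ‖a − b‖ (‖a‖ + ‖b‖)`. [folklore] -/
theorem abs_norm_sq_sub_norm_sq_le_norm_sub_mul {V : Type*} [NormedAddCommGroup V] (a b : V) :
    |‖a‖ ^ 2 - ‖b‖ ^ 2| ≤ ‖a - b‖ * (‖a‖ + ‖b‖) := by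
  rw [sq_sub_sq, abs_mul, abs_of_nonneg (by positivity : (0 : ℝ) ≤ ‖a‖ + ‖b‖), mul_comm]
  exact mul_le_mul_of_nonneg_right (abs_norm_sub_norm_le a b) (by positivity)

/-- **`‖ |f|² − |g|² ‖_{3/2} ≤ ‖f − g‖₃ (‖f‖₃ + ‖g‖₃)`** (pointwise `|‖a‖² − ‖b‖²| ≤ ‖a − b‖(‖a‖ + ‖b‖)`
and Hölder `(3, 3) → 3/2`). [folklore] -/
theorem eLpNorm_threeHalves_norm_sq_sub_norm_sq_le {X : Type*} [MeasurableSpace X] {μ : Measure X}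
    {V : Type*} [NormedAddCommGroup V] {f g : X → V} (hf : AEStronglyMeasurable f μ)
    (hg : AEStronglyMeasurable g μ) :
    eLpNorm ((fun z => ‖f z‖ ^ 2) - fun z => ‖g z‖ ^ 2) (3 / 2 : ℝ≥0∞) μ ≤
      eLpNorm (f - g) 3 μ * (eLpNorm f 3 μ + eLpNorm g 3 μ) := by
  haveI := FunctionSpaces.holderTriple_three_three
  set s : X → ℝ := fun z => ‖f z‖ + ‖g z‖ with hs
  have hsum : AEStronglyMeasurable s μ := hf.norm.add hg.norm
  have h2 : eLpNorm (fun x => ‖(f - g) x‖ * ‖s x‖) (3 / 2 : ℝ≥0∞) μ ≤ eLpNorm (f - g) 3 μ * eLpNorm s 3 μ :=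
    eLpNorm_norm_mul_norm_le_holder₂ (hf.sub hg) hsum (p := 3) (q := 3) (r := 3 / 2)
  have h1 : eLpNorm ((fun z => ‖f z‖ ^ 2) - fun z => ‖g z‖ ^ 2) (3 / 2 : ℝ≥0∞) μ ≤
      eLpNorm (fun x => ‖(f - g) x‖ * ‖s x‖) (3 / 2 : ℝ≥0∞) μ := by
    refine eLpNorm_mono_real fun z => ?_
    have e1 : ‖((fun z => ‖f z‖ ^ 2) - fun z => ‖g z‖ ^ 2) z‖ = |‖f z‖ ^ 2 - ‖g z‖ ^ 2| := Real.norm_eq_abs _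
    have e2 : ‖s z‖ = ‖f z‖ + ‖g z‖ := Real.norm_of_nonneg (add_nonneg (norm_nonneg _) (norm_nonneg _))
    rw [e1, e2]
    exact abs_norm_sq_sub_norm_sq_le_norm_sub_mul (f z) (g z)
  have h3 : eLpNorm s 3 μ ≤ eLpNorm f 3 μ + eLpNorm g 3 μ :=
    calc eLpNorm s 3 μ ≤ eLpNorm (fun z => ‖f z‖) 3 μ + eLpNorm (fun z => ‖g z‖) 3 μ :=
          eLpNorm_add_le hf.norm hg.norm (by norm_num)
      _ = eLpNorm f 3 μ + eLpNorm g 3 μ := by rw [eLpNorm_norm, eLpNorm_norm]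
  exact h1.trans (h2.trans (mul_le_mul' le_rfl h3))

/-- **Continuity of the `L²` pairing**: if `fₙ → f` and `gₙ → g` in `L²` then `∫ ⟪fₙ, gₙ⟫ → ∫ ⟪f, g⟫`
(continuity of the inner product of the Hilbert space `L²`; copy of the tree's
`tendsto_integral_inner_of_tendsto_eLpNorm_two_two`, kept local to spare an import). [folklore] -/
theorem tendsto_integral_inner_L2_pair {X : Type*} [MeasurableSpace X] {μ : Measure X}
    {V : Type*} [NormedAddCommGroup V] [InnerProductSpace ℝ V] [CompleteSpace V]
    {f g : ℕ → X → V} {f₀ g₀ : X → V} (hf : ∀ i, MemLp (f i) 2 μ) (hg : ∀ i, MemLp (g i) 2 μ)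
    (hf₀ : MemLp f₀ 2 μ) (hg₀ : MemLp g₀ 2 μ) (hfl : Tendsto (fun i => eLpNorm (f i - f₀) 2 μ) atTop (𝓝 0))
    (hgl : Tendsto (fun i => eLpNorm (g i - g₀) 2 μ) atTop (𝓝 0)) :
    Tendsto (fun i => ∫ x, ⟪f i x, g i x⟫ ∂μ) atTop (𝓝 (∫ x, ⟪f₀ x, g₀ x⟫ ∂μ)) := by
  haveI : Fact ((1 : ℝ≥0∞) ≤ 2) := ⟨one_le_two⟩
  have hF : Tendsto (fun i => (hf i).toLp (f i)) atTop (𝓝 (hf₀.toLp f₀)) := by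
    rw [Lp.tendsto_Lp_iff_tendsto_eLpNorm']
    refine hfl.congr fun i => ?_
    refine eLpNorm_congr_ae ?_
    filter_upwards [(hf i).coeFn_toLp, hf₀.coeFn_toLp] with x h1 h2
    simp only [Pi.sub_apply, h1, h2]
  have hG : Tendsto (fun i => (hg i).toLp (g i)) atTop (𝓝 (hg₀.toLp g₀)) := by
    rw [Lp.tendsto_Lp_iff_tendsto_eLpNorm']
    refine hgl.congr fun i => ?_
    refine eLpNorm_congr_ae ?_
    filter_upwards [(hg i).coeFn_toLp, hg₀.coeFn_toLp] with x h1 h2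
    simp only [Pi.sub_apply, h1, h2]
  have hinner : ∀ {a b : X → V} (ha : MemLp a 2 μ) (hb : MemLp b 2 μ),
      ⟪ha.toLp a, hb.toLp b⟫ = ∫ x, ⟪a x, b x⟫ ∂μ := by
    intro a b ha hb
    rw [MeasureTheory.L2.inner_def]
    refine integral_congr_ae ?_
    filter_upwards [ha.coeFn_toLp, hb.coeFn_toLp] with x hx hy
    rw [hx, hy]
  have h := hF.inner (𝕜 := ℝ) hG
  rw [hinner hf₀ hg₀] at h
  refine h.congr fun i => ?_
  exact hinner (hf i) (hg i)

set_option maxHeartbeats 800000 in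
/-- **Leray's weak solution is a suitable weak solution on every finite cylinder
`(0, T) × B(0, R)`.** Along Leray's regularised scheme with its pressures and Leray's limit `u`
(slice-wise weak `L²` limit, strong in `L²` at a.e. time), with the jointly measurable Riesz
pressure `p` of the limit, `(u, p)` is a suitable weak solution of the unforced equations with
viscosity `ν` on the cylinder in the sense of Caffarelli–Kohn–Nirenberg / Lin
(`IsSuitableWeakSolutionOn`): the weak identities and Leray's local energy equalities of the
regularised solutions (`setIntegral_weak_identity_regularised`,
`setIntegral_local_energy_regularised`) pass to the limit through the strong `L³` convergence of
`U n` and of the drifts `J U n` to `u`, the strong `L^{3/2}` convergence of the pressures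
(`LeraySchemePressureBounds.lean`), weak `L²` limits of the gradients along a subsequence
(`exists_subseq_weakGradient_weakLimit`) and the weak lower semicontinuity of the dissipation
(`lintegral_frobeniusNormSq_mul_le_of_tendsto`) — the argument of Caffarelli–Kohn–Nirenberg 1982,
Appendix ("the weak solutions constructed by Leray are suitable"), as in the tree's
`isSuitableWeakSolutionOn_of_tendsto`. [cite: CaffarelliKohnNirenberg1982, Appendix] [cite: Leray1934, Ch. V §§26–31] -/
theorem IsLerayRegularisedScheme.isSuitableWeakSolutionOn_limit_cylinder
    (hS : IsLerayRegularisedScheme ν u₀ φ U)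
    (hP : ∀ n T, 0 < T →
      IsClassicalDriftNSSolutionOn (Icc 0 T) ν (fun t => mollify (φ n) (U n t)) (U n) (P n))
    (hPb : ∀ n t, 0 ≤ t → eLpNorm (P n t) 2 volume ≤
      ((9 : ℕ) : ℝ≥0∞) * eLpNorm (fun x => ‖mollify (φ n) (U n t) x‖ * ‖U n t x‖) 2 volume)
    (hν : 0 < ν) (hu₀ : MemLp u₀ 2 volume) (hW : IsSliceWeakLimit U u₀ u)
    (hmeas : AEStronglyMeasurable (uncurry u)
      ((volume.restrict (Ioi (0 : ℝ))).prod (volume : Measure (EuclideanSpace ℝ (Fin 3)))))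
    (hae : ∀ᵐ t ∂(volume.restrict (Ioi (0 : ℝ))),
      Tendsto (fun n => eLpNorm (U n t - u t) 2 volume) atTop (𝓝 0))
    (hpm : StronglyMeasurable (uncurry p))
    (hp : ∀ᵐ t ∂(volume.restrict (Ioi (0 : ℝ))), ∀ᵐ x : EuclideanSpace ℝ (Fin 3),
      p t x = normalisedPressure (u t) x)
    {T : ℝ} (hT : 0 < T) (R : ℝ) :
    IsSuitableWeakSolutionOn
      (⟨Ioo (0 : ℝ) T ×ˢ ball (0 : EuclideanSpace ℝ (Fin 3)) R, isOpen_Ioo.prod isOpen_ball⟩ :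
        Opens (ℝ × EuclideanSpace ℝ (Fin 3))) ν 0 u p := by
  have hE : Module.finrank ℝ (EuclideanSpace ℝ (Fin 3)) = 3 := by simp
  set Q : Opens (ℝ × EuclideanSpace ℝ (Fin 3)) :=
    ⟨Ioo (0 : ℝ) T ×ˢ ball (0 : EuclideanSpace ℝ (Fin 3)) R, isOpen_Ioo.prod isOpen_ball⟩ with hQdef
  set S : Set (ℝ × EuclideanSpace ℝ (Fin 3)) := (Q : Set (ℝ × EuclideanSpace ℝ (Fin 3))) with hSdef
  have hSeq : S = Ioo (0 : ℝ) T ×ˢ ball (0 : EuclideanSpace ℝ (Fin 3)) R := rfl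
  have hSm : MeasurableSet S := Q.isOpen.measurableSet
  have hQsub : S ⊆ Ioo (0 : ℝ) T ×ˢ (univ : Set (EuclideanSpace ℝ (Fin 3))) :=
    prod_mono subset_rfl (subset_univ _)
  have hQfin : volume S ≠ ⊤ := by
    rw [hSeq, Measure.volume_eq_prod, Measure.prod_prod]
    exact ENNReal.mul_ne_top measure_Ioo_lt_top.ne measure_ball_lt_top.ne
  set μQ : Measure (ℝ × EuclideanSpace ℝ (Fin 3)) := volume.restrict S with hμQ
  haveI : IsFiniteMeasure μQ := ⟨by rw [hμQ, Measure.restrict_apply_univ]; exact hQfin.lt_top⟩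
  set μt : Measure ℝ := volume.restrict (Ioo (0 : ℝ) T) with hμt
  set μT : Measure (ℝ × EuclideanSpace ℝ (Fin 3)) := μt.prod volume with hμT
  have hμTeq : μT = volume.restrict (Ioo (0 : ℝ) T ×ˢ (univ : Set (EuclideanSpace ℝ (Fin 3)))) :=
    restrict_prod_volume_eq T
  have hμle : μQ ≤ μT := by rw [hμTeq]; exact Measure.restrict_mono hQsub le_rfl
  have h13 : (1 : ℝ≥0∞) ≤ 3 := by norm_num
  have h23 : (2 : ℝ≥0∞) ≤ 3 := by norm_num
  have h132 : (1 : ℝ≥0∞) ≤ 3 / 2 := FunctionSpaces.ennreal_one_le_three_halves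
  ------------------------------------------------------------------
  -- the drifts, and measurability on `μQ`
  ------------------------------------------------------------------
  set W : ℕ → ℝ → EuclideanSpace ℝ (Fin 3) → EuclideanSpace ℝ (Fin 3) := fun n t => mollify (φ n) (U n t)
    with hWdef
  have hmU : ∀ k, AEStronglyMeasurable (uncurry (U k)) μQ := fun k =>
    (hS.aestronglyMeasurable_uncurry_slab k T).mono_measure hμle
  have hmW : ∀ k, AEStronglyMeasurable (uncurry (W k)) μQ := fun k =>
    (aestronglyMeasurable_drift_prod hP k hT).mono_measure hμle
  have hmP : ∀ k, AEStronglyMeasurable (uncurry (P k)) μQ := fun k =>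
    (aestronglyMeasurable_pressure_prod hP k hT).mono_measure hμle
  have hmu : AEStronglyMeasurable (uncurry u) μQ :=
    (hmeas.mono_measure (prod_restrict_Ioo_le_prod_restrict_Ioi T)).mono_measure hμle
  have hmp : AEStronglyMeasurable (uncurry p) μQ := hpm.aestronglyMeasurable
  ------------------------------------------------------------------
  -- `L³` memberships and convergences on `μQ`
  ------------------------------------------------------------------
  have hM3t := cube_const_ne_top (E := EuclideanSpace ℝ (Fin 3)) (ν := ν) hu₀ T
  set M₃ : ℝ≥0∞ := ENNReal.ofReal T * eLpNorm u₀ 2 volume ^ 2 +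
    (eLpNorm u₀ 2 volume ^ 2) ^ (2 / 3 : ℝ) *
      ((SNormLESNormFDerivOfEqConst (EuclideanSpace ℝ (Fin 3)) (volume : Measure (EuclideanSpace ℝ (Fin 3))) 2 : ℝ≥0∞) ^ 2 *
        ENNReal.ofReal (VectorCalculus.kineticEnergy u₀ / ν)) with hM₃
  have hU3T : ∀ k, ∫⁻ z, ‖uncurry (U k) z‖ₑ ^ (3 : ℝ) ∂μQ ≤ M₃ := fun k =>
    (lintegral_mono' hμle le_rfl).trans (hS.lintegral_prod_cube_le hE hν hu₀ k hT.le)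
  have hU3 : ∀ k, MemLp (uncurry (U k)) 3 μQ ∧ eLpNorm (uncurry (U k)) 3 μQ ≤ M₃ ^ (1 / 3 : ℝ) :=
    fun k => memLp_three_of_lintegral_le (hmU k) hM3t (hU3T k)
  have hu3 : MemLp (uncurry u) 3 μQ := by
    refine ⟨hmu, ?_⟩
    rw [eLpNorm_eq_lintegral_rpow_enorm_toReal (by norm_num) (by norm_num), ENNReal.toReal_ofNat]
    refine ENNReal.rpow_lt_top_of_nonneg (by norm_num) (ne_of_lt ?_)
    exact (lintegral_mono' hμle le_rfl).trans_lt (hS.lintegral_prod_cube_limit_lt_top hE hν hu₀ hW hmeas hae hT.le)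
  have hconvU : Tendsto (fun k => eLpNorm (uncurry (U k) - uncurry u) 3 μQ) atTop (𝓝 0) := by
    refine tendsto_eLpNorm_three_of_lintegral ?_
    refine tendsto_of_tendsto_of_tendsto_of_le_of_le tendsto_const_nhds
      (hS.tendsto_lintegral_prod_sub_cube hE hν hu₀ hW hmeas hae hT.le) (fun _ => zero_le) fun k => ?_
    exact lintegral_mono' hμle le_rfl
  have hconvW : Tendsto (fun k => eLpNorm (uncurry (W k) - uncurry u) 3 μQ) atTop (𝓝 0) := by
    refine tendsto_eLpNorm_three_of_lintegral ?_
    refine tendsto_of_tendsto_of_tendsto_of_le_of_le tendsto_const_nhds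
      (hS.tendsto_lintegral_prod_mollify_sub_cube hE hν hu₀ hW hmeas hae hT.le) (fun _ => zero_le) fun k => ?_
    exact lintegral_mono' hμle le_rfl
  have hW3 : ∀ k, MemLp (uncurry (W k)) 3 μQ := fun k => by
    have h : MemLp (uncurry (W k) - uncurry u) 3 μQ := by
      refine ⟨(hmW k).sub hmu, ?_⟩
      -- eventually small, in particular finite: use the bound by `W k - u` on the slab at index `k`
      rw [eLpNorm_eq_lintegral_rpow_enorm_toReal (by norm_num) (by norm_num), ENNReal.toReal_ofNat]
      refine ENNReal.rpow_lt_top_of_nonneg (by norm_num) (ne_of_lt ?_)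
      refine (lintegral_mono' hμle le_rfl).trans_lt ?_
      -- `J U k - u ∈ L³` of the slab: `J U k ∈ L³` slice-wise bounded by `U k`, and `u ∈ L³`
      have hmeasWu : AEMeasurable (fun z : ℝ × EuclideanSpace ℝ (Fin 3) =>
          ‖(uncurry (W k) - uncurry u) z‖ₑ ^ (3 : ℝ)) μT :=
        ((aestronglyMeasurable_drift_prod hP k hT).sub
          (hmeas.mono_measure (prod_restrict_Ioo_le_prod_restrict_Ioi T))).enorm.pow_const _
      calc ∫⁻ z, ‖(uncurry (W k) - uncurry u) z‖ₑ ^ (3 : ℝ) ∂μT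
          ≤ ∫⁻ z, 4 * (‖uncurry (W k) z‖ₑ ^ (3 : ℝ) + ‖uncurry u z‖ₑ ^ (3 : ℝ)) ∂μT := by
            refine lintegral_mono fun z => ?_
            have h := enorm_add_rpow_three_le₁ (uncurry (W k) z) (-(uncurry u z))
            rwa [enorm_neg, ← sub_eq_add_neg] at h
        _ = 4 * ((∫⁻ z, ‖uncurry (W k) z‖ₑ ^ (3 : ℝ) ∂μT) + ∫⁻ z, ‖uncurry u z‖ₑ ^ (3 : ℝ) ∂μT) := by
            rw [lintegral_const_mul' _ _ (by norm_num),
              lintegral_add_left' ((aestronglyMeasurable_drift_prod hP k hT).enorm.pow_const _)]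
        _ < ⊤ := by
            refine ENNReal.mul_lt_top (by norm_num) (ENNReal.add_lt_top.2 ⟨?_, ?_⟩)
            · -- slice-wise Young
              calc ∫⁻ z, ‖uncurry (W k) z‖ₑ ^ (3 : ℝ) ∂μT
                  ≤ ∫⁻ t, (∫⁻ x, ‖W k t x‖ₑ ^ (3 : ℝ)) ∂μt := lintegral_prod_le _
                _ ≤ ∫⁻ t, (∫⁻ x, ‖U k t x‖ₑ ^ (3 : ℝ)) ∂μt := by
                    refine lintegral_mono_ae ?_
                    filter_upwards [ae_restrict_mem (measurableSet_Ioo : MeasurableSet (Ioo (0 : ℝ) T))] with t ht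
                    have e1 : (∫⁻ x, ‖W k t x‖ₑ ^ (3 : ℝ)) = eLpNorm (W k t) 3 volume ^ (3 : ℝ) := by
                      rw [eLpNorm_three_rpow_eq]; norm_num
                    have e2 : (∫⁻ x, ‖U k t x‖ₑ ^ (3 : ℝ)) = eLpNorm (U k t) 3 volume ^ (3 : ℝ) := by
                      rw [eLpNorm_three_rpow_eq]; norm_num
                    rw [e1, e2]
                    gcongr
                    exact FunctionSpaces.eLpNorm_normed_convolution_le (φ k) (hS.memLp k ht.1.le).1 (by norm_num)
                _ = ∫⁻ z, ‖uncurry (U k) z‖ₑ ^ (3 : ℝ) ∂μT :=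
                    (lintegral_prod _ ((hS.aestronglyMeasurable_uncurry_slab k T).enorm.pow_const _)).symm
                _ < ⊤ := (hS.lintegral_prod_cube_le hE hν hu₀ k hT.le).trans_lt hM3t.lt_top
            · exact hS.lintegral_prod_cube_limit_lt_top hE hν hu₀ hW hmeas hae hT.le
    have := h.add hu3
    simpa using this
  -- `L²` versions
  have hU2 : ∀ k, MemLp (uncurry (U k)) 2 μQ := fun k => (hU3 k).1.mono_exponent h23
  have hW2 : ∀ k, MemLp (uncurry (W k)) 2 μQ := fun k => (hW3 k).mono_exponent h23
  have hu2 : MemLp (uncurry u) 2 μQ := hu3.mono_exponent h23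
  have hu1 : Integrable (uncurry u) μQ := hu3.integrable h13
  have hconvU2 : Tendsto (fun k => eLpNorm (uncurry (U k) - uncurry u) 2 μQ) atTop (𝓝 0) :=
    tendsto_eLpNorm_two_of_three (fun k => (hmU k).sub hmu) hconvU
  have hconvWU3 : Tendsto (fun k => eLpNorm (uncurry (W k) - uncurry (U k)) 3 μQ) atTop (𝓝 0) := by
    have hle : ∀ k, eLpNorm (uncurry (W k) - uncurry (U k)) 3 μQ ≤
        eLpNorm (uncurry (W k) - uncurry u) 3 μQ + eLpNorm (uncurry (U k) - uncurry u) 3 μQ := fun k => by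
      have e : uncurry (W k) - uncurry (U k) = (uncurry (W k) - uncurry u) - (uncurry (U k) - uncurry u) := by abel
      rw [e]
      exact eLpNorm_sub_le ((hmW k).sub hmu) ((hmU k).sub hmu) h13
    have h := hconvW.add hconvU
    rw [add_zero] at h
    exact tendsto_of_tendsto_of_tendsto_of_le_of_le tendsto_const_nhds h (fun _ => zero_le) hle
  have hconvWU2 : Tendsto (fun k => eLpNorm (uncurry (W k) - uncurry (U k)) 2 μQ) atTop (𝓝 0) :=
    tendsto_eLpNorm_two_of_three (fun k => (hmW k).sub (hmU k)) hconvWU3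
  ------------------------------------------------------------------
  -- the pressures on `μQ`
  ------------------------------------------------------------------
  obtain ⟨C₁, hC₁t, hC₁⟩ := hS.exists_lintegral_pressure_slice_le hP hPb
  have hPT : ∀ k, ∫⁻ z, ‖P k z.1 z.2‖ₑ ^ (3 / 2 : ℝ) ∂μT ≤ C₁ * M₃ := fun k =>
    (hS.lintegral_prod_pressure_le hP hC₁ k hT).trans (mul_le_mul' le_rfl (hS.lintegral_prod_cube_le hE hν hu₀ k hT.le))
  have hpconvT := hS.tendsto_lintegral_prod_pressure_sub hP hPb hν hu₀ hW hmeas hae hpm hp hT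
  set Cp : ℝ≥0∞ := 2 ^ ((3 / 2 : ℝ) - 1) * (1 + C₁ * M₃) with hCp
  have hCpt : Cp ≠ ⊤ := ENNReal.mul_ne_top (ENNReal.rpow_ne_top_of_nonneg (by norm_num) ENNReal.ofNat_ne_top)
    (ENNReal.add_ne_top.2 ⟨ENNReal.one_ne_top, ENNReal.mul_ne_top hC₁t hM3t⟩)
  have hCpge : C₁ * M₃ ≤ Cp := by
    have h1 : (1 : ℝ≥0∞) ≤ 2 ^ ((3 / 2 : ℝ) - 1) := ENNReal.one_le_rpow one_le_two (by norm_num)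
    calc C₁ * M₃ ≤ 1 + C₁ * M₃ := le_add_self
      _ = 1 * (1 + C₁ * M₃) := (one_mul _).symm
      _ ≤ Cp := mul_le_mul' h1 le_rfl
  have hPb' : ∀ k, ∫⁻ z in S, ‖P k z.1 z.2‖ₑ ^ (3 / 2 : ℝ) ≤ Cp := fun k =>
    ((lintegral_mono' hμle le_rfl).trans (hPT k)).trans hCpge
  have hpT : ∫⁻ z, ‖p z.1 z.2‖ₑ ^ (3 / 2 : ℝ) ∂μT ≤ Cp := by
    obtain ⟨k, hk⟩ : ∃ k, ∫⁻ z, ‖P k z.1 z.2 - p z.1 z.2‖ₑ ^ (3 / 2 : ℝ) ∂μT ≤ 1 :=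
      ((ENNReal.tendsto_nhds_zero.1 hpconvT) 1 one_pos).exists
    have hmPT : AEMeasurable (fun z : ℝ × EuclideanSpace ℝ (Fin 3) => ‖P k z.1 z.2‖ₑ ^ (3 / 2 : ℝ)) μT :=
      (aestronglyMeasurable_pressure_prod hP k hT).enorm.pow_const _
    calc ∫⁻ z, ‖p z.1 z.2‖ₑ ^ (3 / 2 : ℝ) ∂μT
        ≤ ∫⁻ z, 2 ^ ((3 / 2 : ℝ) - 1) * (‖P k z.1 z.2 - p z.1 z.2‖ₑ ^ (3 / 2 : ℝ) + ‖P k z.1 z.2‖ₑ ^ (3 / 2 : ℝ)) ∂μT := by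
          refine lintegral_mono fun z => ?_
          have e : p z.1 z.2 = P k z.1 z.2 - (P k z.1 z.2 - p z.1 z.2) := by ring
          calc ‖p z.1 z.2‖ₑ ^ (3 / 2 : ℝ) = ‖P k z.1 z.2 - (P k z.1 z.2 - p z.1 z.2)‖ₑ ^ (3 / 2 : ℝ) := by rw [← e]
            _ ≤ (‖P k z.1 z.2‖ₑ + ‖P k z.1 z.2 - p z.1 z.2‖ₑ) ^ (3 / 2 : ℝ) := by
                gcongr; exact enorm_sub_le
            _ ≤ 2 ^ ((3 / 2 : ℝ) - 1) * (‖P k z.1 z.2‖ₑ ^ (3 / 2 : ℝ) + ‖P k z.1 z.2 - p z.1 z.2‖ₑ ^ (3 / 2 : ℝ)) :=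
                ENNReal.rpow_add_le_mul_rpow_add_rpow _ _ (by norm_num)
            _ = _ := by rw [add_comm]
      _ = 2 ^ ((3 / 2 : ℝ) - 1) * ((∫⁻ z, ‖P k z.1 z.2 - p z.1 z.2‖ₑ ^ (3 / 2 : ℝ) ∂μT) +
            ∫⁻ z, ‖P k z.1 z.2‖ₑ ^ (3 / 2 : ℝ) ∂μT) := by
          rw [lintegral_const_mul' _ _ (ENNReal.rpow_ne_top_of_nonneg (by norm_num) ENNReal.ofNat_ne_top),
            lintegral_add_right' _ hmPT]
      _ ≤ Cp := by
          simp only [hCp]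
          exact mul_le_mul' le_rfl (add_le_add hk (hPT k))
  have hpb : ∫⁻ z in S, ‖p z.1 z.2‖ₑ ^ (3 / 2 : ℝ) ≤ Cp := (lintegral_mono' hμle le_rfl).trans hpT
  have hPmem : ∀ k, MemLp (uncurry (P k)) (3 / 2) μQ ∧ eLpNorm (uncurry (P k)) (3 / 2) μQ ≤ Cp ^ (1 / (3 / 2 : ℝ)) :=
    fun k => memLp_threeHalves_of_lintegral_le (hmP k) hCpt (hPb' k)
  have hpmem := memLp_threeHalves_of_lintegral_le hmp hCpt hpb
  have hMt : Cp ^ (1 / (3 / 2 : ℝ)) ≠ ⊤ := ENNReal.rpow_ne_top_of_nonneg (by norm_num) hCpt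
  have hp1 : Integrable (uncurry p) μQ := hpmem.1.integrable h132
  have hP1 : ∀ k, Integrable (uncurry (P k)) μQ := fun k => (hPmem k).1.integrable h132
  -- strong, hence weak, convergence of the pressures in `L^{3/2}(μQ)`
  have hpconv : Tendsto (fun k => eLpNorm (uncurry (P k) - uncurry p) (3 / 2) μQ) atTop (𝓝 0) := by
    have h32_0 : (3 / 2 : ℝ≥0∞) ≠ 0 := by norm_num
    have h32_t : (3 / 2 : ℝ≥0∞) ≠ ⊤ := ENNReal.div_ne_top (by norm_num) (by norm_num)
    have h1 : Tendsto (fun k => ∫⁻ z, ‖(uncurry (P k) - uncurry p) z‖ₑ ^ (3 / 2 : ℝ) ∂μQ) atTop (𝓝 0) :=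
      tendsto_of_tendsto_of_tendsto_of_le_of_le tendsto_const_nhds hpconvT (fun _ => zero_le)
        fun k => lintegral_mono' hμle le_rfl
    have h2 := ((ENNReal.continuous_rpow_const (y := (1 / (3 / 2 : ℝ)))).tendsto 0).comp h1
    rw [ENNReal.zero_rpow_of_pos (by norm_num)] at h2
    refine h2.congr fun k => ?_
    simp only [Function.comp_apply]
    rw [eLpNorm_eq_lintegral_rpow_enorm_toReal h32_0 h32_t, toReal_three_halves_eq]
  have hπw : ∀ g : ℝ × EuclideanSpace ℝ (Fin 3) → ℝ, MemLp g 3 μQ →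
      Tendsto (fun k => ∫ z, uncurry (P k) z * g z ∂μQ) atTop (𝓝 (∫ z, uncurry p z * g z ∂μQ)) := by
    intro g hg
    have h := FunctionSpaces.tendsto_integral_mul_mul (μ := μQ) (A := fun k => uncurry (P k)) (A' := uncurry p)
      (B := fun _ => g) (B' := g) (fun k => hmP k) hmp (fun _ => hg.1) hg.1 hpmem.1.2 hg.2 hpconv
      (by simp) (c := fun _ => (1 : ℝ)) aestronglyMeasurable_const
      (C := 1) (fun _ => by simp)
    simpa using h
  ------------------------------------------------------------------
  -- the gradients: uniform bound, and the weak limit along a subsequence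
  ------------------------------------------------------------------
  set G : ℕ → ℝ → EuclideanSpace ℝ (Fin 3) → EuclideanSpace ℝ (Fin 3) →L[ℝ] EuclideanSpace ℝ (Fin 3) :=
    fun k t x => fderiv ℝ (U k t) x with hGdef
  have hG : ∀ k, HasWeakSpatialGradientOn Q (U k) (G k) := fun k =>
    hasWeakSpatialGradientOn_of_contDiffOn isOpen_Ioo hQsub ((drift_regularity_on_Ioo hP k hT).1.of_le one_le_two)
  set Cg : ℝ≥0∞ := ENNReal.ofReal (VectorCalculus.kineticEnergy u₀ / ν) with hCg
  have hGb : ∀ k, ∫⁻ z in S, ENNReal.ofReal (frobeniusNormSq (G k z.1 z.2)) ≤ Cg := fun k => by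
    calc ∫⁻ z in S, ENNReal.ofReal (frobeniusNormSq (G k z.1 z.2))
        ≤ ∫⁻ z, ENNReal.ofReal (frobeniusNormSq (G k z.1 z.2)) ∂μT := lintegral_mono' hμle le_rfl
      _ ≤ ∫⁻ t, (∫⁻ x, ENNReal.ofReal (frobeniusNormSq (fderiv ℝ (U k t) x))) ∂μt := lintegral_prod_le _
      _ ≤ Cg := hS.lintegral_dissipation_le hν hu₀ k hT.le
  obtain ⟨σ, Gu, hσ, hGu, hGu2, hGw⟩ :=
    exists_subseq_weakGradient_weakLimit hQfin ENNReal.ofReal_ne_top hG hGb hU2 hu2 hconvU2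
  have hGu2' : ∫⁻ z in S, ENNReal.ofReal (frobeniusNormSq (Gu z.1 z.2)) < ⊤ :=
    hGu2.trans_lt ENNReal.ofReal_lt_top
  ------------------------------------------------------------------
  -- bounded weights and integrable pairings
  ------------------------------------------------------------------
  have happ : Continuous (uncurry fun (L : EuclideanSpace ℝ (Fin 3) →L[ℝ] EuclideanSpace ℝ (Fin 3))
      (x : EuclideanSpace ℝ (Fin 3)) => L x) := isBoundedBilinearMap_apply.continuous
  have hbd : ∀ {w : ℝ × EuclideanSpace ℝ (Fin 3) → EuclideanSpace ℝ (Fin 3)}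
      {g : ℝ × EuclideanSpace ℝ (Fin 3) → EuclideanSpace ℝ (Fin 3)} {C : ℝ},
      MemLp w 2 μQ → AEStronglyMeasurable g μQ → (∀ z, ‖g z‖ ≤ C) →
      Integrable (fun z => ⟪w z, g z⟫) μQ := fun {w g C} hw hg hgC => by
    have hw1 : Integrable w μQ := hw.integrable one_le_two
    refine (hw1.norm.mul_const C).mono' (hw.1.inner hg) (Eventually.of_forall fun z => ?_)
    exact (norm_inner_le_norm _ _).trans (mul_le_mul_of_nonneg_left (hgC z) (norm_nonneg _))
  ------------------------------------------------------------------
  -- (1) the distributional equations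
  ------------------------------------------------------------------
  have hdist : IsDistributionalNSSolutionOn Q ν 0 u p := by
    refine ⟨IntegrableOn.locallyIntegrableOn hu1, ?_, IntegrableOn.locallyIntegrableOn hp1,
      fun θ hθ => ?_, fun ψ hψ => ?_⟩
    · exact IntegrableOn.locallyIntegrableOn ((memLp_two_iff_integrable_sq_norm hu2.1).1 hu2)
    · -- divergence free, from the slices of `u`
      obtain ⟨C, hC0, -, -, hgC, -⟩ := hθ.exists_scalar_weights_bound
      have hgm : AEStronglyMeasurable (fun z : ℝ × EuclideanSpace ℝ (Fin 3) => gradient (θ z.1) z.2) μQ :=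
        hθ.continuous_slice_gradient.aestronglyMeasurable
      have hI : IntegrableOn (fun z : ℝ × EuclideanSpace ℝ (Fin 3) => ⟪u z.1 z.2, gradient (θ z.1) z.2⟫) S volume :=
        hbd hu2 hgm hgC
      have h0 : ∀ z : ℝ × EuclideanSpace ℝ (Fin 3), z ∉ S → ⟪u z.1 z.2, gradient (θ z.1) z.2⟫ = 0 := fun z hz => by
        rw [gradient_eq_zero_of_notMem_tsupport (notMem_tsupport_slice_of_notMem fun h => hz (hθ.tsupport_subset h)),
          inner_zero_right]
      change ∫ z in S, ⟪u z.1 z.2, gradient (θ z.1) z.2⟫ = 0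
      rw [← integral_integral_eq_setIntegral hI h0]
      refine integral_eq_zero_of_ae (Eventually.of_forall fun t => ?_)
      by_cases ht : 0 ≤ t
      · exact hW.isWeaklyDivFree t ht (θ t) ⟨hθ.contDiff_slice t, hθ.hasCompactSupport_slice t, fun _ _ => trivial⟩
      · refine integral_eq_zero_of_ae (Eventually.of_forall fun x => h0 (t, x) fun h => ht ?_)
        exact (hQsub h).1.1.le
    · -- the momentum equation
      obtain ⟨C, hC0, htC, hDC, hΔC, hdivC⟩ := hψ.exists_weights_bound
      have htm : AEStronglyMeasurable (fun z : ℝ × EuclideanSpace ℝ (Fin 3) => timeDeriv ψ z.1 z.2) μQ :=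
        hψ.continuous_timeDeriv.aestronglyMeasurable
      have hDm : AEStronglyMeasurable (fun z : ℝ × EuclideanSpace ℝ (Fin 3) => fderiv ℝ (ψ z.1) z.2) μQ :=
        hψ.continuous_fderiv_slice.aestronglyMeasurable
      have hΔm : AEStronglyMeasurable (fun z : ℝ × EuclideanSpace ℝ (Fin 3) => Δ (ψ z.1) z.2) μQ :=
        hψ.continuous_laplacian_slice.aestronglyMeasurable
      have hdivm : AEStronglyMeasurable (fun z : ℝ × EuclideanSpace ℝ (Fin 3) =>
          VectorCalculus.divergence (ψ z.1) z.2) μQ := hψ.continuous_divergence_slice.aestronglyMeasurable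
      have hdiv3 : MemLp (fun z : ℝ × EuclideanSpace ℝ (Fin 3) => VectorCalculus.divergence (ψ z.1) z.2) 3 μQ :=
        (memLp_top_of_bound hdivm C (Eventually.of_forall hdivC)).mono_exponent le_top
      -- the transported fields `z ↦ Dψ(z) b(z)` for `b ∈ L²`
      have hDb : ∀ {b : ℝ × EuclideanSpace ℝ (Fin 3) → EuclideanSpace ℝ (Fin 3)}, MemLp b 2 μQ →
          MemLp (fun z => fderiv ℝ (ψ z.1) z.2 (b z)) 2 μQ := fun {b} hb => by
        refine MemLp.of_le_mul (c := C) hb (happ.comp_aestronglyMeasurable₂ hDm hb.1)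
          (Eventually.of_forall fun z => ?_)
        exact (ContinuousLinearMap.le_opNorm _ _).trans (mul_le_mul_of_nonneg_right (hDC z) (norm_nonneg _))
      have hDbconv : ∀ {b : ℕ → ℝ × EuclideanSpace ℝ (Fin 3) → EuclideanSpace ℝ (Fin 3)}
          {b₀ : ℝ × EuclideanSpace ℝ (Fin 3) → EuclideanSpace ℝ (Fin 3)},
          (∀ k, AEStronglyMeasurable (b k) μQ) → AEStronglyMeasurable b₀ μQ →
          Tendsto (fun k => eLpNorm (b k - b₀) 2 μQ) atTop (𝓝 0) →
          Tendsto (fun k => eLpNorm ((fun z => fderiv ℝ (ψ z.1) z.2 (b k z)) - fun z => fderiv ℝ (ψ z.1) z.2 (b₀ z)) 2 μQ)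
            atTop (𝓝 0) := by
        intro b b₀ hbm hb₀m hconv
        have hle : ∀ k, eLpNorm ((fun z => fderiv ℝ (ψ z.1) z.2 (b k z)) - fun z => fderiv ℝ (ψ z.1) z.2 (b₀ z)) 2 μQ
            ≤ ENNReal.ofReal C * eLpNorm (b k - b₀) 2 μQ := fun k => by
          refine eLpNorm_le_mul_eLpNorm_of_ae_le_mul (Eventually.of_forall fun z => ?_) 2
          simp only [Pi.sub_apply, ← map_sub]
          exact (ContinuousLinearMap.le_opNorm _ _).trans (mul_le_mul_of_nonneg_right (hDC z) (norm_nonneg _))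
        have h := ENNReal.Tendsto.const_mul hconv (a := ENNReal.ofReal C) (Or.inr ENNReal.ofReal_ne_top)
        rw [mul_zero] at h
        exact tendsto_of_tendsto_of_tendsto_of_le_of_le tendsto_const_nhds h (fun _ => zero_le) hle
      -- splitting of the tested integrand (drift form, no force)
      have hsplit : ∀ {w b : ℝ → EuclideanSpace ℝ (Fin 3) → EuclideanSpace ℝ (Fin 3)} {q : ℝ → EuclideanSpace ℝ (Fin 3) → ℝ},
          MemLp (uncurry w) 2 μQ → MemLp (uncurry b) 2 μQ → Integrable (uncurry q) μQ →
          ∫ z, (⟪w z.1 z.2, timeDeriv ψ z.1 z.2⟫ + ⟪w z.1 z.2, convect (b z.1) (ψ z.1) z.2⟫ +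
            ν * ⟪w z.1 z.2, Δ (ψ z.1) z.2⟫ + q z.1 z.2 * VectorCalculus.divergence (ψ z.1) z.2) ∂μQ =
          ((∫ z, ⟪uncurry w z, timeDeriv ψ z.1 z.2⟫ ∂μQ) +
            ∫ z, ⟪uncurry w z, fderiv ℝ (ψ z.1) z.2 (uncurry b z)⟫ ∂μQ) +
          (ν * ∫ z, ⟪uncurry w z, Δ (ψ z.1) z.2⟫ ∂μQ +
            ∫ z, uncurry q z * VectorCalculus.divergence (ψ z.1) z.2 ∂μQ) := by
        intro w b q hw hb hq
        have hw1 : Integrable (uncurry w) μQ := hw.integrable one_le_two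
        have i1 := hbd hw htm htC
        have i2 : Integrable (fun z => ⟪uncurry w z, fderiv ℝ (ψ z.1) z.2 (uncurry b z)⟫) μQ := by
          have h := (hDb hb)
          haveI : ENNReal.HolderConjugate (2 : ℝ≥0∞) 2 := ENNReal.HolderConjugate.instTwoTwo
          have hprod : Integrable (fun z => ‖fderiv ℝ (ψ z.1) z.2 (uncurry b z)‖ * ‖uncurry w z‖) μQ :=
            memLp_one_iff_integrable.1 (MemLp.mul' hw.norm h.norm)
          refine hprod.mono' (hw.1.inner h.1) (Eventually.of_forall fun z => ?_)
          rw [mul_comm]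
          exact norm_inner_le_norm _ _
        have i3 : Integrable (fun z => ν * ⟪uncurry w z, Δ (ψ z.1) z.2⟫) μQ := (hbd hw hΔm hΔC).const_mul ν
        have i4 : Integrable (fun z => uncurry q z * VectorCalculus.divergence (ψ z.1) z.2) μQ :=
          (hq.bdd_mul hdivm (Eventually.of_forall hdivC)).congr (Eventually.of_forall fun z => mul_comm _ _)
        have i12 : Integrable (fun z => ⟪uncurry w z, timeDeriv ψ z.1 z.2⟫ +
            ⟪uncurry w z, fderiv ℝ (ψ z.1) z.2 (uncurry b z)⟫) μQ := i1.add i2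
        have i34 : Integrable (fun z => ν * ⟪uncurry w z, Δ (ψ z.1) z.2⟫ +
            uncurry q z * VectorCalculus.divergence (ψ z.1) z.2) μQ := i3.add i4
        have e1 := integral_add i1 i2
        have e2 := integral_add i3 i4
        have e12 := integral_add i12 i34
        have e3 := integral_const_mul (μ := μQ) ν (fun z : ℝ × EuclideanSpace ℝ (Fin 3) => ⟪uncurry w z, Δ (ψ z.1) z.2⟫)
        rw [← e3, ← e1, ← e2, ← e12]
        refine integral_congr_ae (Eventually.of_forall fun z => ?_)
        simp only [convect, uncurry]
        ring
      -- the limits of the four pieces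
      have hl1 : Tendsto (fun k => ∫ z, ⟪uncurry (U k) z, timeDeriv ψ z.1 z.2⟫ ∂μQ) atTop
          (𝓝 (∫ z, ⟪uncurry u z, timeDeriv ψ z.1 z.2⟫ ∂μQ)) :=
        tendsto_integral_inner_of_tendsto_eLpNorm_two_bdd hU2 hu2 hconvU2 htm hC0 htC
      have hconvW2 : Tendsto (fun k => eLpNorm (uncurry (W k) - uncurry u) 2 μQ) atTop (𝓝 0) :=
        tendsto_eLpNorm_two_of_three (fun k => (hmW k).sub hmu) hconvW
      have hl2 : Tendsto (fun k => ∫ z, ⟪uncurry (U k) z, fderiv ℝ (ψ z.1) z.2 (uncurry (W k) z)⟫ ∂μQ)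
          atTop (𝓝 (∫ z, ⟪uncurry u z, fderiv ℝ (ψ z.1) z.2 (uncurry u z)⟫ ∂μQ)) :=
        tendsto_integral_inner_L2_pair hU2 (fun k => hDb (hW2 k)) hu2 (hDb hu2) hconvU2
          (hDbconv (fun k => (hW2 k).1) hu2.1 hconvW2)
      have hl3 : Tendsto (fun k => ν * ∫ z, ⟪uncurry (U k) z, Δ (ψ z.1) z.2⟫ ∂μQ) atTop
          (𝓝 (ν * ∫ z, ⟪uncurry u z, Δ (ψ z.1) z.2⟫ ∂μQ)) :=
        (tendsto_integral_inner_of_tendsto_eLpNorm_two_bdd hU2 hu2 hconvU2 hΔm hC0 hΔC).const_mul ν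
      have hl4 : Tendsto (fun k => ∫ z, uncurry (P k) z * VectorCalculus.divergence (ψ z.1) z.2 ∂μQ)
          atTop (𝓝 (∫ z, uncurry p z * VectorCalculus.divergence (ψ z.1) z.2 ∂μQ)) := hπw _ hdiv3
      have hlim := (hl1.add hl2).add (hl3.add hl4)
      have hk : ∀ k, ((∫ z, ⟪uncurry (U k) z, timeDeriv ψ z.1 z.2⟫ ∂μQ) +
          ∫ z, ⟪uncurry (U k) z, fderiv ℝ (ψ z.1) z.2 (uncurry (W k) z)⟫ ∂μQ) +
          (ν * ∫ z, ⟪uncurry (U k) z, Δ (ψ z.1) z.2⟫ ∂μQ +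
            ∫ z, uncurry (P k) z * VectorCalculus.divergence (ψ z.1) z.2 ∂μQ) = 0 := fun k => by
        rw [← hsplit (hU2 k) (hW2 k) (hP1 k)]
        exact setIntegral_weak_identity_regularised hP k hT hQsub hψ
      simp only [hk] at hlim
      have h := tendsto_nhds_unique tendsto_const_nhds hlim
      -- the limit identity, with the zero force
      have e0 : ∫ z in S, (⟪u z.1 z.2, timeDeriv ψ z.1 z.2⟫ + ⟪u z.1 z.2, convect (u z.1) (ψ z.1) z.2⟫ +
          ν * ⟪u z.1 z.2, Δ (ψ z.1) z.2⟫ + p z.1 z.2 * VectorCalculus.divergence (ψ z.1) z.2 +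
          ⟪(0 : ℝ → EuclideanSpace ℝ (Fin 3) → EuclideanSpace ℝ (Fin 3)) z.1 z.2, ψ z.1 z.2⟫) =
          ∫ z, (⟪u z.1 z.2, timeDeriv ψ z.1 z.2⟫ + ⟪u z.1 z.2, convect (u z.1) (ψ z.1) z.2⟫ +
          ν * ⟪u z.1 z.2, Δ (ψ z.1) z.2⟫ + p z.1 z.2 * VectorCalculus.divergence (ψ z.1) z.2) ∂μQ :=
        integral_congr_ae (Eventually.of_forall fun z => by simp only [Pi.zero_apply, inner_zero_left, add_zero])
      change ∫ z in S, _ = 0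
      rw [e0, hsplit hu2 hu2 hp1]
      exact h.symm
  ------------------------------------------------------------------
  -- (2) the energy class
  ------------------------------------------------------------------
  have huE : ∀ K ⊆ S, IsCompact K → ∃ C : ℝ≥0, ∀ᵐ t : ℝ,
      ∫⁻ x, K.indicator (fun z : ℝ × EuclideanSpace ℝ (Fin 3) => ‖u z.1 z.2‖ₑ ^ 2) (t, x) ≤ C := by
    intro K hK _
    refine ⟨(eLpNorm u₀ 2 volume ^ 2).toNNReal, Eventually.of_forall fun t => ?_⟩
    rw [ENNReal.coe_toNNReal (ENNReal.pow_ne_top hu₀.eLpNorm_ne_top)]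
    by_cases ht : 0 ≤ t
    · calc ∫⁻ x, K.indicator (fun z : ℝ × EuclideanSpace ℝ (Fin 3) => ‖u z.1 z.2‖ₑ ^ 2) (t, x)
          ≤ ∫⁻ x, ‖u t x‖ₑ ^ 2 := by
            refine lintegral_mono fun x => ?_
            by_cases hz : (t, x) ∈ K
            · rw [indicator_of_mem hz]
            · rw [indicator_of_notMem hz]; exact zero_le
        _ = eLpNorm (u t) 2 volume ^ 2 := FourierNS.lintegral_enorm_sq_eq_eLpNorm_sq volume (u t)
        _ ≤ eLpNorm u₀ 2 volume ^ 2 := by gcongr; exact hW.eLpNorm_le t ht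
    · have h0 : ∀ x, K.indicator (fun z : ℝ × EuclideanSpace ℝ (Fin 3) => ‖u z.1 z.2‖ₑ ^ 2) (t, x) = 0 := by
        intro x
        rw [indicator_of_notMem]
        intro h
        exact ht (hQsub (hK h)).1.1.le
      simp only [h0, lintegral_zero]
      exact zero_le
  ------------------------------------------------------------------
  -- (3)–(4) the classes and the local energy inequality
  ------------------------------------------------------------------
  refine
    { distributional := hdist
      energyClass := huE
      pressure := fun K hK _ => (lintegral_mono_set hK).trans_lt (hpb.trans_lt hCpt.lt_top)
      localEnergy := ⟨Gu, hGu, fun K hK _ => (lintegral_mono_set hK).trans_lt hGu2', ?_⟩ }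
  intro θ hθ hθ0
  obtain ⟨C, hC0, hθC, htC, hgC, hΔC⟩ := hθ.exists_scalar_weights_bound
  -- measurability of the weights
  have hθm : AEStronglyMeasurable (uncurry θ) μQ := hθ.contDiff.continuous.aestronglyMeasurable
  have htθm : AEStronglyMeasurable (fun z : ℝ × EuclideanSpace ℝ (Fin 3) => timeDeriv θ z.1 z.2) μQ :=
    hθ.continuous_timeDeriv.aestronglyMeasurable
  have hgθm : AEStronglyMeasurable (fun z : ℝ × EuclideanSpace ℝ (Fin 3) => gradient (θ z.1) z.2) μQ :=
    hθ.continuous_slice_gradient.aestronglyMeasurable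
  have hΔθm : AEStronglyMeasurable (fun z : ℝ × EuclideanSpace ℝ (Fin 3) => Δ (θ z.1) z.2) μQ :=
    hθ.continuous_laplacian_slice.aestronglyMeasurable
  -- the local energy equalities of the approximants along `σ`
  have hk := fun k => setIntegral_local_energy_regularised hP (σ k) hT hQsub hθ
  ------------------------------------------------------------------
  -- convergence of the right-hand sides
  ------------------------------------------------------------------
  -- piece A: `∫ ‖U‖² (θₜ + νΔθ) → ∫ ‖u‖² (θₜ + νΔθ)`
  have hwA : AEStronglyMeasurable (fun z : ℝ × EuclideanSpace ℝ (Fin 3) => timeDeriv θ z.1 z.2 + ν * Δ (θ z.1) z.2) μQ :=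
    htθm.add (hΔθm.const_mul ν)
  have hwAC : ∀ z : ℝ × EuclideanSpace ℝ (Fin 3), ‖timeDeriv θ z.1 z.2 + ν * Δ (θ z.1) z.2‖ ≤ C + |ν| * C := fun z =>
    (norm_add_le _ _).trans (add_le_add (htC z) (by rw [norm_mul, Real.norm_eq_abs]; exact mul_le_mul_of_nonneg_left (hΔC z) (abs_nonneg _)))
  have hA : Tendsto (fun k => ∫ z, (timeDeriv θ z.1 z.2 + ν * Δ (θ z.1) z.2) * ‖uncurry (U (σ k)) z‖ ^ 2 ∂μQ) atTop
      (𝓝 (∫ z, (timeDeriv θ z.1 z.2 + ν * Δ (θ z.1) z.2) * ‖uncurry u z‖ ^ 2 ∂μQ)) :=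
    FunctionSpaces.tendsto_integral_mul_norm_sq (fun k => (hmU (σ k))) hu2 (hconvU2.comp hσ.tendsto_atTop) hwA
      (by positivity) hwAC
  -- piece B: `∫ ‖U‖² ⟪W, ∇θ⟫ → ∫ ‖u‖² ⟪u, ∇θ⟫` (`L^{3/2} × L³`)
  have hsqm : ∀ {w : ℝ × EuclideanSpace ℝ (Fin 3) → EuclideanSpace ℝ (Fin 3)}, AEStronglyMeasurable w μQ →
      AEStronglyMeasurable (fun z => ‖w z‖ ^ 2) μQ := fun hw => hw.norm.pow 2
  have hsq32 : ∀ {w : ℝ × EuclideanSpace ℝ (Fin 3) → EuclideanSpace ℝ (Fin 3)}, MemLp w 3 μQ →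
      MemLp (fun z => ‖w z‖ ^ 2) (3 / 2 : ℝ≥0∞) μQ := fun hw => by
    haveI := FunctionSpaces.holderTriple_three_three
    exact memLp_norm_sq_of_memLp_holder (p := 3) (r := 3 / 2) hw
  have hsqconv : Tendsto (fun k => eLpNorm ((fun z => ‖uncurry (U (σ k)) z‖ ^ 2) - fun z => ‖uncurry u z‖ ^ 2)
      (3 / 2 : ℝ≥0∞) μQ) atTop (𝓝 0) := by
    -- `|‖a‖² − ‖b‖²| ≤ ‖a − b‖ (‖a‖ + ‖b‖)`
    have hle : ∀ k, eLpNorm ((fun z => ‖uncurry (U (σ k)) z‖ ^ 2) - fun z => ‖uncurry u z‖ ^ 2) (3 / 2 : ℝ≥0∞) μQ ≤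
        eLpNorm (uncurry (U (σ k)) - uncurry u) 3 μQ * (M₃ ^ (1 / 3 : ℝ) + eLpNorm (uncurry u) 3 μQ) := fun k =>
      (eLpNorm_threeHalves_norm_sq_sub_norm_sq_le (hmU (σ k)) hmu).trans
        (mul_le_mul' le_rfl (add_le_add (hU3 (σ k)).2 le_rfl))
    have hfin : M₃ ^ (1 / 3 : ℝ) + eLpNorm (uncurry u) 3 μQ ≠ ⊤ :=
      ENNReal.add_ne_top.2 ⟨ENNReal.rpow_ne_top_of_nonneg (by norm_num) hM3t, hu3.eLpNorm_ne_top⟩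
    have h := ENNReal.Tendsto.mul_const (hconvU.comp hσ.tendsto_atTop) (Or.inr hfin)
    rw [zero_mul] at h
    exact tendsto_of_tendsto_of_tendsto_of_le_of_le tendsto_const_nhds h (fun _ => zero_le) hle
  have hinner3 : ∀ {w : ℝ × EuclideanSpace ℝ (Fin 3) → EuclideanSpace ℝ (Fin 3)}, AEStronglyMeasurable w μQ →
      eLpNorm (fun z => ⟪w z, gradient (θ z.1) z.2⟫) 3 μQ ≤ ENNReal.ofReal C * eLpNorm w 3 μQ := fun {w} hw => by
    refine eLpNorm_le_mul_eLpNorm_of_ae_le_mul (Eventually.of_forall fun z => ?_) 3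
    rw [real_inner_comm]
    exact (norm_inner_le_norm _ _).trans (mul_le_mul_of_nonneg_right (hgC z) (norm_nonneg _))
  have hinner3m : ∀ {w : ℝ × EuclideanSpace ℝ (Fin 3) → EuclideanSpace ℝ (Fin 3)}, MemLp w 3 μQ →
      MemLp (fun z => ⟪w z, gradient (θ z.1) z.2⟫) 3 μQ := fun {w} hw =>
    ⟨hw.1.inner hgθm, (hinner3 hw.1).trans_lt (ENNReal.mul_lt_top ENNReal.ofReal_lt_top hw.eLpNorm_lt_top)⟩
  have hB : Tendsto (fun k => ∫ z, (1 : ℝ) * (‖uncurry (U (σ k)) z‖ ^ 2 * ⟪uncurry (W (σ k)) z, gradient (θ z.1) z.2⟫) ∂μQ) atTop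
      (𝓝 (∫ z, (1 : ℝ) * (‖uncurry u z‖ ^ 2 * ⟪uncurry u z, gradient (θ z.1) z.2⟫) ∂μQ)) := by
    refine FunctionSpaces.tendsto_integral_mul_mul (μ := μQ) (fun k => hsqm (hmU (σ k))) (hsqm hmu)
      (fun k => (hmW (σ k)).inner hgθm) (hmu.inner hgθm) (hsq32 hu3).eLpNorm_lt_top (hinner3m hu3).eLpNorm_lt_top
      hsqconv ?_ aestronglyMeasurable_const (C := 1) (fun _ => by simp)
    -- `⟪W − u, ∇θ⟫ → 0` in `L³`
    have hle : ∀ k, eLpNorm ((fun z => ⟪uncurry (W (σ k)) z, gradient (θ z.1) z.2⟫) - fun z => ⟪uncurry u z, gradient (θ z.1) z.2⟫) 3 μQ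
        ≤ ENNReal.ofReal C * eLpNorm (uncurry (W (σ k)) - uncurry u) 3 μQ := fun k => by
      have e : ((fun z => ⟪uncurry (W (σ k)) z, gradient (θ z.1) z.2⟫) - fun z => ⟪uncurry u z, gradient (θ z.1) z.2⟫) =
          fun z => ⟪(uncurry (W (σ k)) - uncurry u) z, gradient (θ z.1) z.2⟫ := by
        funext z; simp only [Pi.sub_apply, inner_sub_left]
      rw [e]
      exact hinner3 ((hmW (σ k)).sub hmu)
    have h := ENNReal.Tendsto.const_mul (hconvW.comp hσ.tendsto_atTop) (a := ENNReal.ofReal C) (Or.inr ENNReal.ofReal_ne_top)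
    rw [mul_zero] at h
    exact tendsto_of_tendsto_of_tendsto_of_le_of_le tendsto_const_nhds h (fun _ => zero_le) hle
  simp only [one_mul] at hB
  -- piece C: `∫ P ⟪U, ∇θ⟫ → ∫ p ⟪u, ∇θ⟫` (weak–strong)
  have hCpiece : Tendsto (fun k => ∫ z, uncurry (P (σ k)) z * ⟪uncurry (U (σ k)) z, gradient (θ z.1) z.2⟫ ∂μQ) atTop
      (𝓝 (∫ z, uncurry p z * ⟪uncurry u z, gradient (θ z.1) z.2⟫ ∂μQ)) :=
    tendsto_integral_mul_inner_of_weak_strong hMt (fun k => hmP (σ k)) (fun k => (hPmem (σ k)).2)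
      (fun g hg => (hπw g hg).comp hσ.tendsto_atTop) (fun k => (hU3 (σ k)).1) hu3 (hconvU.comp hσ.tendsto_atTop) hgθm hgC
  -- assembling the right-hand sides
  have hRsplit : ∀ {w b : ℝ → EuclideanSpace ℝ (Fin 3) → EuclideanSpace ℝ (Fin 3)} {q : ℝ → EuclideanSpace ℝ (Fin 3) → ℝ},
      MemLp (uncurry w) 3 μQ → MemLp (uncurry b) 3 μQ → MemLp (uncurry q) (3 / 2) μQ →
      ∫ z, (‖w z.1 z.2‖ ^ 2 * (timeDeriv θ z.1 z.2 + ν * (Δ (θ z.1)) z.2) +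
          ‖w z.1 z.2‖ ^ 2 * ⟪b z.1 z.2, gradient (θ z.1) z.2⟫ + 2 * q z.1 z.2 * ⟪w z.1 z.2, gradient (θ z.1) z.2⟫) ∂μQ =
        (∫ z, (timeDeriv θ z.1 z.2 + ν * Δ (θ z.1) z.2) * ‖uncurry w z‖ ^ 2 ∂μQ) +
          (∫ z, ‖uncurry w z‖ ^ 2 * ⟪uncurry b z, gradient (θ z.1) z.2⟫ ∂μQ) +
          2 * ∫ z, uncurry q z * ⟪uncurry w z, gradient (θ z.1) z.2⟫ ∂μQ := by
    intro w b q hw hb hq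
    have i1 : Integrable (fun z => (timeDeriv θ z.1 z.2 + ν * Δ (θ z.1) z.2) * ‖uncurry w z‖ ^ 2) μQ := by
      have h2 : Integrable (fun z => ‖uncurry w z‖ ^ 2) μQ :=
        (memLp_two_iff_integrable_sq_norm (hw.mono_exponent h23).1).1 (hw.mono_exponent h23)
      exact (h2.bdd_mul hwA (Eventually.of_forall hwAC))
    have i2 : Integrable (fun z => ‖uncurry w z‖ ^ 2 * ⟪uncurry b z, gradient (θ z.1) z.2⟫) μQ :=
      memLp_one_iff_integrable.1 (MemLp.mul' (hinner3m hb) (hsq32 hw) (hpqr := FunctionSpaces.holderTriple_threeHalves_three))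
    have i3 : Integrable (fun z => uncurry q z * ⟪uncurry w z, gradient (θ z.1) z.2⟫) μQ :=
      memLp_one_iff_integrable.1 (MemLp.mul' (hinner3m hw) hq (hpqr := FunctionSpaces.holderTriple_threeHalves_three))
    have i12 : Integrable (fun z => (timeDeriv θ z.1 z.2 + ν * Δ (θ z.1) z.2) * ‖uncurry w z‖ ^ 2 +
        ‖uncurry w z‖ ^ 2 * ⟪uncurry b z, gradient (θ z.1) z.2⟫) μQ := i1.add i2
    have i3' : Integrable (fun z => 2 * (uncurry q z * ⟪uncurry w z, gradient (θ z.1) z.2⟫)) μQ := i3.const_mul 2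
    rw [← integral_const_mul, ← integral_add i1 i2, ← integral_add i12 i3']
    refine integral_congr_ae (Eventually.of_forall fun z => ?_)
    simp only [uncurry]
    ring
  set Ru : ℝ := ∫ z, (‖u z.1 z.2‖ ^ 2 * (timeDeriv θ z.1 z.2 + ν * Δ (θ z.1) z.2) +
    (‖u z.1 z.2‖ ^ 2 + 2 * p z.1 z.2) * ⟪u z.1 z.2, gradient (θ z.1) z.2⟫) ∂μQ with hRu
  have hRu_eq : Ru = (∫ z, (timeDeriv θ z.1 z.2 + ν * Δ (θ z.1) z.2) * ‖uncurry u z‖ ^ 2 ∂μQ) +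
      (∫ z, ‖uncurry u z‖ ^ 2 * ⟪uncurry u z, gradient (θ z.1) z.2⟫ ∂μQ) +
      2 * ∫ z, uncurry p z * ⟪uncurry u z, gradient (θ z.1) z.2⟫ ∂μQ := by
    rw [hRu, ← hRsplit hu3 hu3 hpmem.1]
    refine integral_congr_ae (Eventually.of_forall fun z => ?_)
    ring
  have hR : Tendsto (fun k => ∫ z in S, (‖U (σ k) z.1 z.2‖ ^ 2 * (timeDeriv θ z.1 z.2 + ν * (Δ (θ z.1)) z.2) +
      ‖U (σ k) z.1 z.2‖ ^ 2 * ⟪W (σ k) z.1 z.2, gradient (θ z.1) z.2⟫ +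
      2 * P (σ k) z.1 z.2 * ⟪U (σ k) z.1 z.2, gradient (θ z.1) z.2⟫)) atTop (𝓝 Ru) := by
    rw [hRu_eq]
    have h := (hA.add hB).add (hCpiece.const_mul 2)
    refine h.congr fun k => ?_
    exact (hRsplit (hU3 (σ k)).1 (hW3 (σ k)) (hPmem (σ k)).1).symm
  ------------------------------------------------------------------
  -- weak lower semicontinuity of the dissipation
  ------------------------------------------------------------------
  have hGum : AEStronglyMeasurable (uncurry Gu) μQ := hGu.locallyIntegrableOn_grad.aestronglyMeasurable
  have hGm : ∀ k, AEStronglyMeasurable (uncurry (G (σ k))) μQ := fun k =>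
    (hG (σ k)).locallyIntegrableOn_grad.aestronglyMeasurable
  have hfrobm : AEStronglyMeasurable (fun z : ℝ × EuclideanSpace ℝ (Fin 3) => frobeniusNormSq (Gu z.1 z.2)) μQ :=
    LerayHopfProofs.continuous_frobeniusNormSq.comp_aestronglyMeasurable hGum
  have hIGu : IntegrableOn (fun z : ℝ × EuclideanSpace ℝ (Fin 3) => frobeniusNormSq (Gu z.1 z.2) * θ z.1 z.2) S volume := by
    have hf : Integrable (fun z : ℝ × EuclideanSpace ℝ (Fin 3) => frobeniusNormSq (Gu z.1 z.2)) μQ := by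
      refine ⟨hfrobm, ?_⟩
      rw [hasFiniteIntegral_iff_enorm]
      refine lt_of_le_of_lt (lintegral_mono fun z => ?_) hGu2'
      rw [Real.enorm_eq_ofReal (frobeniusNormSq_nonneg _)]
    refine (hf.mul_const C).mono' (hfrobm.mul hθm) (Eventually.of_forall fun z => ?_)
    rw [norm_mul, Real.norm_of_nonneg (frobeniusNormSq_nonneg _)]
    exact mul_le_mul_of_nonneg_left (hθC z) (frobeniusNormSq_nonneg _)
  -- pass to set integrals
  rw [integral_integral_frobeniusNormSq_mul_eq hθ hIGu, integral_integral_lei_rhs_eq hQfin ν hu3 hpmem.1 hθ]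
  change 2 * ν * ∫ z, frobeniusNormSq (Gu z.1 z.2) * θ z.1 z.2 ∂μQ ≤ Ru
  -- nonnegativity of the right-hand sides
  have hRk0 : ∀ k, 0 ≤ ∫ z in S, (‖U (σ k) z.1 z.2‖ ^ 2 * (timeDeriv θ z.1 z.2 + ν * (Δ (θ z.1)) z.2) +
      ‖U (σ k) z.1 z.2‖ ^ 2 * ⟪W (σ k) z.1 z.2, gradient (θ z.1) z.2⟫ +
      2 * P (σ k) z.1 z.2 * ⟪U (σ k) z.1 z.2, gradient (θ z.1) z.2⟫) := fun k => by
    rw [← (hk k).2]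
    exact mul_nonneg (mul_nonneg zero_le_two hν.le)
      (integral_nonneg fun z => mul_nonneg (frobeniusNormSq_nonneg _) (hθ0 _ _))
  have hRu0 : 0 ≤ Ru := ge_of_tendsto' hR hRk0
  have h2ν : 0 < 2 * ν := by positivity
  set I : ℝ := ∫ z, frobeniusNormSq (Gu z.1 z.2) * θ z.1 z.2 ∂μQ with hI
  suffices hmain : ∀ ε, 0 < ε → 2 * ν * I ≤ Ru + ε from le_of_forall_pos_le_add hmain
  intro ε hε
  set B : ℝ≥0∞ := ENNReal.ofReal ((Ru + ε) / (2 * ν)) with hB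
  have hev : ∀ᶠ k in atTop, ∫⁻ z, ENNReal.ofReal (frobeniusNormSq (uncurry (G (σ k)) z) * uncurry θ z) ∂μQ ≤ B := by
    filter_upwards [(tendsto_order.1 hR).2 (Ru + ε) (lt_add_of_pos_right _ hε)] with k hklt
    have hint : Integrable (fun z : ℝ × EuclideanSpace ℝ (Fin 3) => frobeniusNormSq (G (σ k) z.1 z.2) * θ z.1 z.2) μQ := (hk k).1
    have hnn : 0 ≤ᵐ[μQ] fun z : ℝ × EuclideanSpace ℝ (Fin 3) => frobeniusNormSq (G (σ k) z.1 z.2) * θ z.1 z.2 :=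
      Eventually.of_forall fun z => mul_nonneg (frobeniusNormSq_nonneg _) (hθ0 _ _)
    have e := ofReal_integral_eq_lintegral_ofReal hint hnn
    change ∫⁻ z, ENNReal.ofReal (frobeniusNormSq (G (σ k) z.1 z.2) * θ z.1 z.2) ∂μQ ≤ B
    rw [← e, hB]
    refine ENNReal.ofReal_le_ofReal ?_
    rw [le_div_iff₀ h2ν, mul_comm]
    exact (le_of_eq (hk k).2).trans hklt.le
  have hlsc := lintegral_frobeniusNormSq_mul_le_of_tendsto (μ := μQ) (G := fun k => uncurry (G (σ k)))
    (Gu := uncurry Gu) (φ := uncurry θ) (C := C) hGm hGum hGu2' hθm (fun z => hθ0 _ _)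
    (fun z => (le_abs_self _).trans ((Real.norm_eq_abs _).symm.le.trans (hθC z))) hGw hev
  -- back to real numbers
  have hnn : 0 ≤ᵐ[μQ] fun z : ℝ × EuclideanSpace ℝ (Fin 3) => frobeniusNormSq (Gu z.1 z.2) * θ z.1 z.2 :=
    Eventually.of_forall fun z => mul_nonneg (frobeniusNormSq_nonneg _) (hθ0 _ _)
  have e := ofReal_integral_eq_lintegral_ofReal hIGu hnn
  change ∫⁻ z, ENNReal.ofReal (frobeniusNormSq (Gu z.1 z.2) * θ z.1 z.2) ∂μQ ≤ B at hlsc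
  rw [← e, hB, ENNReal.ofReal_le_ofReal_iff (div_nonneg (by linarith) h2ν.le)] at hlsc
  rw [mul_comm, ← le_div_iff₀ h2ν]
  exact hlsc

end Limit

section Packaging

variable {ν : ℝ} {u₀ : EuclideanSpace ℝ (Fin 3) → EuclideanSpace ℝ (Fin 3)}
  {φ : ℕ → ContDiffBump (0 : EuclideanSpace ℝ (Fin 3))}
  {U : ℕ → ℝ → EuclideanSpace ℝ (Fin 3) → EuclideanSpace ℝ (Fin 3)}
  {P : ℕ → ℝ → EuclideanSpace ℝ (Fin 3) → ℝ}
  {u : ℝ → EuclideanSpace ℝ (Fin 3) → EuclideanSpace ℝ (Fin 3)}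
  {p : ℝ → EuclideanSpace ℝ (Fin 3) → ℝ}

/-- From `∫⁻ ‖f‖ₑ² < ∞` to `f ∈ L²`. [folklore] -/
theorem memLp_two_of_lintegral_sq_finite {X : Type*} [MeasurableSpace X] {μ : Measure X}
    {F : Type*} [NormedAddCommGroup F] {f : X → F} (hfm : AEStronglyMeasurable f μ)
    (h : ∫⁻ x, ‖f x‖ₑ ^ 2 ∂μ < ⊤) : MemLp f 2 μ := by
  refine ⟨hfm, ?_⟩
  rw [eLpNorm_eq_lintegral_rpow_enorm_toReal two_ne_zero ENNReal.ofNat_ne_top, ENNReal.toReal_ofNat]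
  refine ENNReal.rpow_lt_top_of_nonneg (by norm_num) (ne_of_lt ?_)
  simpa only [ENNReal.rpow_two] using h

/-- `‖f‖_{L²(μ)} → 0` from `∫⁻ ‖f‖ₑ² dμ → 0`. [folklore] -/
theorem tendsto_eLpNorm_two_of_lintegral_sq {X : Type*} [MeasurableSpace X] {μ : Measure X}
    {F : Type*} [NormedAddCommGroup F] {f : ℕ → X → F}
    (h : Tendsto (fun k => ∫⁻ x, ‖f k x‖ₑ ^ 2 ∂μ) atTop (𝓝 0)) :
    Tendsto (fun k => eLpNorm (f k) 2 μ) atTop (𝓝 0) := by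
  have h1 := ((ENNReal.continuous_rpow_const (y := (1 / 2 : ℝ))).tendsto 0).comp h
  rw [ENNReal.zero_rpow_of_pos (by norm_num)] at h1
  refine h1.congr fun k => ?_
  simp only [Function.comp_apply]
  rw [eLpNorm_eq_lintegral_rpow_enorm_toReal two_ne_zero ENNReal.ofNat_ne_top, ENNReal.toReal_ofNat]
  simp only [ENNReal.rpow_two]

/-- **A weak spatial gradient of Leray's limit on a cylinder, with the global dissipation bound**:
on `(0, T) × B(0, R)` the limit `u` has a weak spatial gradient `G` with
`∫∫ |G|² ≤ ½‖u₀‖₂² / ν` (weak `L²` limit of `∇U_{σ k}` along a subsequence, the bound by lower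
semicontinuity; Leray 1934, §31, the bound on `W(t)`). [cite: Leray1934, Ch. V §31] -/
theorem IsLerayRegularisedScheme.exists_hasWeakSpatialGradientOn_cylinder_le
    (hS : IsLerayRegularisedScheme ν u₀ φ U)
    (hP : ∀ n T, 0 < T →
      IsClassicalDriftNSSolutionOn (Icc 0 T) ν (fun t => mollify (φ n) (U n t)) (U n) (P n))
    (hν : 0 < ν) (hu₀ : MemLp u₀ 2 volume) (hW : IsSliceWeakLimit U u₀ u)
    (hmeas : AEStronglyMeasurable (uncurry u)
      ((volume.restrict (Ioi (0 : ℝ))).prod (volume : Measure (EuclideanSpace ℝ (Fin 3)))))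
    (hae : ∀ᵐ t ∂(volume.restrict (Ioi (0 : ℝ))),
      Tendsto (fun n => eLpNorm (U n t - u t) 2 volume) atTop (𝓝 0))
    {T : ℝ} (hT : 0 < T) (R : ℝ) :
    ∃ G : ℝ → EuclideanSpace ℝ (Fin 3) → EuclideanSpace ℝ (Fin 3) →L[ℝ] EuclideanSpace ℝ (Fin 3),
      HasWeakSpatialGradientOn
        (⟨Ioo (0 : ℝ) T ×ˢ ball (0 : EuclideanSpace ℝ (Fin 3)) R, isOpen_Ioo.prod isOpen_ball⟩ :
          Opens (ℝ × EuclideanSpace ℝ (Fin 3))) u G ∧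
      ∫⁻ z in Ioo (0 : ℝ) T ×ˢ ball (0 : EuclideanSpace ℝ (Fin 3)) R,
          ENNReal.ofReal (frobeniusNormSq (G z.1 z.2)) ≤
        ENNReal.ofReal (VectorCalculus.kineticEnergy u₀ / ν) := by
  set Q : Opens (ℝ × EuclideanSpace ℝ (Fin 3)) :=
    ⟨Ioo (0 : ℝ) T ×ˢ ball (0 : EuclideanSpace ℝ (Fin 3)) R, isOpen_Ioo.prod isOpen_ball⟩ with hQdef
  set S : Set (ℝ × EuclideanSpace ℝ (Fin 3)) := (Q : Set (ℝ × EuclideanSpace ℝ (Fin 3))) with hSdef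
  have hSeq : S = Ioo (0 : ℝ) T ×ˢ ball (0 : EuclideanSpace ℝ (Fin 3)) R := rfl
  have hQsub : S ⊆ Ioo (0 : ℝ) T ×ˢ (univ : Set (EuclideanSpace ℝ (Fin 3))) :=
    prod_mono subset_rfl (subset_univ _)
  have hQfin : volume S ≠ ⊤ := by
    rw [hSeq, Measure.volume_eq_prod, Measure.prod_prod]
    exact ENNReal.mul_ne_top measure_Ioo_lt_top.ne measure_ball_lt_top.ne
  set μQ : Measure (ℝ × EuclideanSpace ℝ (Fin 3)) := volume.restrict S with hμQ
  set μt : Measure ℝ := volume.restrict (Ioo (0 : ℝ) T) with hμt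
  set μT : Measure (ℝ × EuclideanSpace ℝ (Fin 3)) := μt.prod volume with hμT
  have hμTeq : μT = volume.restrict (Ioo (0 : ℝ) T ×ˢ (univ : Set (EuclideanSpace ℝ (Fin 3)))) :=
    restrict_prod_volume_eq T
  have hμle : μQ ≤ μT := by rw [hμTeq]; exact Measure.restrict_mono hQsub le_rfl
  have hmU : ∀ k, AEStronglyMeasurable (uncurry (U k)) μQ := fun k =>
    (hS.aestronglyMeasurable_uncurry_slab k T).mono_measure hμle
  have hmu : AEStronglyMeasurable (uncurry u) μQ :=
    (hmeas.mono_measure (prod_restrict_Ioo_le_prod_restrict_Ioi T)).mono_measure hμle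
  have h2fin : ENNReal.ofReal T * eLpNorm u₀ 2 volume ^ 2 < ⊤ :=
    ENNReal.mul_lt_top ENNReal.ofReal_lt_top (ENNReal.pow_lt_top hu₀.eLpNorm_lt_top)
  -- `L²` memberships and the strong convergence on the cylinder
  have hU2 : ∀ k, MemLp (uncurry (U k)) 2 μQ := fun k => by
    refine memLp_two_of_lintegral_sq_finite (hmU k) ?_
    calc ∫⁻ z, ‖uncurry (U k) z‖ₑ ^ 2 ∂μQ ≤ ∫⁻ z, ‖U k z.1 z.2‖ₑ ^ 2 ∂μT := lintegral_mono' hμle le_rfl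
      _ ≤ ENNReal.ofReal T * eLpNorm u₀ 2 volume ^ 2 := hS.lintegral_prod_sq_le hν hu₀ k T
      _ < ⊤ := h2fin
  have hu2 : MemLp (uncurry u) 2 μQ := by
    refine memLp_two_of_lintegral_sq_finite hmu ?_
    calc ∫⁻ z, ‖uncurry u z‖ₑ ^ 2 ∂μQ ≤ ∫⁻ z, ‖u z.1 z.2‖ₑ ^ 2 ∂μT := lintegral_mono' hμle le_rfl
      _ ≤ ∫⁻ t, (∫⁻ x, ‖u t x‖ₑ ^ 2) ∂μt := lintegral_prod_le _
      _ ≤ ∫⁻ _t, eLpNorm u₀ 2 volume ^ 2 ∂μt := by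
          refine lintegral_mono_ae ?_
          filter_upwards [ae_restrict_mem (measurableSet_Ioo : MeasurableSet (Ioo (0 : ℝ) T))] with t ht
          rw [FourierNS.lintegral_enorm_sq_eq_eLpNorm_sq volume (u t)]
          gcongr
          exact hW.eLpNorm_le t ht.1.le
      _ = ENNReal.ofReal T * eLpNorm u₀ 2 volume ^ 2 := by
          rw [lintegral_const, hμt, Measure.restrict_apply_univ, Real.volume_Ioo, sub_zero, mul_comm]
      _ < ⊤ := h2fin
  have hconvU2 : Tendsto (fun k => eLpNorm (uncurry (U k) - uncurry u) 2 μQ) atTop (𝓝 0) := by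
    refine tendsto_eLpNorm_two_of_lintegral_sq ?_
    refine tendsto_of_tendsto_of_tendsto_of_le_of_le tendsto_const_nhds
      (hS.tendsto_lintegral_prod_sub_sq hν hu₀ hW hmeas hae T) (fun _ => zero_le) fun k => ?_
    exact lintegral_mono' hμle le_rfl
  -- the gradients: uniform bound, and the weak limit along a subsequence
  set G : ℕ → ℝ → EuclideanSpace ℝ (Fin 3) → EuclideanSpace ℝ (Fin 3) →L[ℝ] EuclideanSpace ℝ (Fin 3) :=
    fun k t x => fderiv ℝ (U k t) x with hGdef
  have hG : ∀ k, HasWeakSpatialGradientOn Q (U k) (G k) := fun k =>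
    hasWeakSpatialGradientOn_of_contDiffOn isOpen_Ioo hQsub ((drift_regularity_on_Ioo hP k hT).1.of_le one_le_two)
  have hGb : ∀ k, ∫⁻ z in S, ENNReal.ofReal (frobeniusNormSq (G k z.1 z.2)) ≤
      ENNReal.ofReal (VectorCalculus.kineticEnergy u₀ / ν) := fun k => by
    calc ∫⁻ z in S, ENNReal.ofReal (frobeniusNormSq (G k z.1 z.2))
        ≤ ∫⁻ z, ENNReal.ofReal (frobeniusNormSq (G k z.1 z.2)) ∂μT := lintegral_mono' hμle le_rfl
      _ ≤ ∫⁻ t, (∫⁻ x, ENNReal.ofReal (frobeniusNormSq (fderiv ℝ (U k t) x))) ∂μt := lintegral_prod_le _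
      _ ≤ _ := hS.lintegral_dissipation_le hν hu₀ k hT.le
  obtain ⟨σ, Gu, -, hGu, hGu2, -⟩ :=
    exists_subseq_weakGradient_weakLimit hQfin ENNReal.ofReal_ne_top hG hGb hU2 hu2 hconvU2
  exact ⟨Gu, hGu, hGu2⟩

/-- **Leray's weak solution is a suitable weak solution on every strip `(0, T) × ℝ³`** (from the
cylinders by exhaustion, `IsSuitableWeakSolutionOn.of_exhaustion`). [cite: CaffarelliKohnNirenberg1982, Appendix] -/
theorem IsLerayRegularisedScheme.isSuitableWeakSolutionOn_limit_slab
    (hS : IsLerayRegularisedScheme ν u₀ φ U)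
    (hP : ∀ n T, 0 < T →
      IsClassicalDriftNSSolutionOn (Icc 0 T) ν (fun t => mollify (φ n) (U n t)) (U n) (P n))
    (hPb : ∀ n t, 0 ≤ t → eLpNorm (P n t) 2 volume ≤
      ((9 : ℕ) : ℝ≥0∞) * eLpNorm (fun x => ‖mollify (φ n) (U n t) x‖ * ‖U n t x‖) 2 volume)
    (hν : 0 < ν) (hu₀ : MemLp u₀ 2 volume) (hW : IsSliceWeakLimit U u₀ u)
    (hmeas : AEStronglyMeasurable (uncurry u)
      ((volume.restrict (Ioi (0 : ℝ))).prod (volume : Measure (EuclideanSpace ℝ (Fin 3)))))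
    (hae : ∀ᵐ t ∂(volume.restrict (Ioi (0 : ℝ))),
      Tendsto (fun n => eLpNorm (U n t - u t) 2 volume) atTop (𝓝 0))
    (hpm : StronglyMeasurable (uncurry p))
    (hp : ∀ᵐ t ∂(volume.restrict (Ioi (0 : ℝ))), ∀ᵐ x : EuclideanSpace ℝ (Fin 3),
      p t x = normalisedPressure (u t) x)
    {T : ℝ} (hT : 0 < T) :
    IsSuitableWeakSolutionOn (slab (EuclideanSpace ℝ (Fin 3)) (Ioo 0 T) isOpen_Ioo) ν 0 u p := by
  set Qn : ℕ → Opens (ℝ × EuclideanSpace ℝ (Fin 3)) := fun m =>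
    ⟨Ioo (0 : ℝ) T ×ˢ ball (0 : EuclideanSpace ℝ (Fin 3)) ((m : ℝ) + 1), isOpen_Ioo.prod isOpen_ball⟩ with hQn
  have hle : ∀ m, Qn m ≤ slab (EuclideanSpace ℝ (Fin 3)) (Ioo 0 T) isOpen_Ioo := fun m z hz =>
    mem_slab.2 (mem_prod.1 hz).1
  have hmono : Monotone Qn := by
    intro m m' hmm' z hz
    obtain ⟨h1, h2⟩ := mem_prod.1 hz
    refine mem_prod.2 ⟨h1, ?_⟩
    exact ball_subset_ball (by linarith [(Nat.cast_le (α := ℝ)).2 hmm']) h2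
  have hcov : ∀ K ⊆ ((slab (EuclideanSpace ℝ (Fin 3)) (Ioo 0 T) isOpen_Ioo : Opens (ℝ × EuclideanSpace ℝ (Fin 3))) :
      Set (ℝ × EuclideanSpace ℝ (Fin 3))), IsCompact K → ∃ m, K ⊆ (Qn m : Set (ℝ × EuclideanSpace ℝ (Fin 3))) := by
    intro K hK hKc
    obtain ⟨R, hR⟩ := exists_snd_subset_closedBall_of_isCompact hKc
    obtain ⟨m, hm⟩ := exists_nat_gt R
    refine ⟨m, fun z hz => mem_prod.2 ⟨mem_slab.1 (hK hz), ?_⟩⟩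
    have h1 : z.2 ∈ closedBall (0 : EuclideanSpace ℝ (Fin 3)) R := hR z hz
    rw [mem_closedBall] at h1
    rw [mem_ball]
    linarith
  exact IsSuitableWeakSolutionOn.of_exhaustion hle hmono hcov fun m =>
    hS.isSuitableWeakSolutionOn_limit_cylinder hP hPb hν hu₀ hW hmeas hae hpm hp hT _

/-- **The limit pressure is in `L^{3/2}` of every strip** `(0, T) × ℝ³` (the regularised
pressures are bounded there uniformly, `lintegral_prod_pressure_le`, and converge strongly,
`tendsto_lintegral_prod_pressure_sub`). [cite: CaffarelliKohnNirenberg1982, Appendix] -/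
theorem IsLerayRegularisedScheme.lintegral_limit_pressure_lt_top
    (hS : IsLerayRegularisedScheme ν u₀ φ U)
    (hP : ∀ n T, 0 < T →
      IsClassicalDriftNSSolutionOn (Icc 0 T) ν (fun t => mollify (φ n) (U n t)) (U n) (P n))
    (hPb : ∀ n t, 0 ≤ t → eLpNorm (P n t) 2 volume ≤
      ((9 : ℕ) : ℝ≥0∞) * eLpNorm (fun x => ‖mollify (φ n) (U n t) x‖ * ‖U n t x‖) 2 volume)
    (hν : 0 < ν) (hu₀ : MemLp u₀ 2 volume) (hW : IsSliceWeakLimit U u₀ u)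
    (hmeas : AEStronglyMeasurable (uncurry u)
      ((volume.restrict (Ioi (0 : ℝ))).prod (volume : Measure (EuclideanSpace ℝ (Fin 3)))))
    (hae : ∀ᵐ t ∂(volume.restrict (Ioi (0 : ℝ))),
      Tendsto (fun n => eLpNorm (U n t - u t) 2 volume) atTop (𝓝 0))
    (hpm : StronglyMeasurable (uncurry p))
    (hp : ∀ᵐ t ∂(volume.restrict (Ioi (0 : ℝ))), ∀ᵐ x : EuclideanSpace ℝ (Fin 3),
      p t x = normalisedPressure (u t) x)
    {T : ℝ} (hT : 0 < T) :
    ∫⁻ z in Ioo (0 : ℝ) T ×ˢ (univ : Set (EuclideanSpace ℝ (Fin 3))), ‖p z.1 z.2‖ₑ ^ (3 / 2 : ℝ) < ⊤ := by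
  have hE : Module.finrank ℝ (EuclideanSpace ℝ (Fin 3)) = 3 := by simp
  set μt : Measure ℝ := volume.restrict (Ioo (0 : ℝ) T) with hμt
  set μT : Measure (ℝ × EuclideanSpace ℝ (Fin 3)) := μt.prod volume with hμT
  have hμTeq : μT = volume.restrict (Ioo (0 : ℝ) T ×ˢ (univ : Set (EuclideanSpace ℝ (Fin 3)))) :=
    restrict_prod_volume_eq T
  rw [← hμTeq]
  obtain ⟨C₁, hC₁t, hC₁⟩ := hS.exists_lintegral_pressure_slice_le hP hPb
  have hM3t := cube_const_ne_top (E := EuclideanSpace ℝ (Fin 3)) (ν := ν) hu₀ T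
  have hpconvT := hS.tendsto_lintegral_prod_pressure_sub hP hPb hν hu₀ hW hmeas hae hpm hp hT
  obtain ⟨k, hk⟩ : ∃ k, ∫⁻ z, ‖P k z.1 z.2 - p z.1 z.2‖ₑ ^ (3 / 2 : ℝ) ∂μT ≤ 1 :=
    ((ENNReal.tendsto_nhds_zero.1 hpconvT) 1 one_pos).exists
  have hmPT : AEMeasurable (fun z : ℝ × EuclideanSpace ℝ (Fin 3) => ‖P k z.1 z.2‖ₑ ^ (3 / 2 : ℝ)) μT :=
    (aestronglyMeasurable_pressure_prod hP k hT).enorm.pow_const _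
  have hPk : ∫⁻ z, ‖P k z.1 z.2‖ₑ ^ (3 / 2 : ℝ) ∂μT < ⊤ :=
    ((hS.lintegral_prod_pressure_le hP hC₁ k hT).trans
      (mul_le_mul' le_rfl (hS.lintegral_prod_cube_le hE hν hu₀ k hT.le))).trans_lt
      (ENNReal.mul_lt_top hC₁t.lt_top hM3t.lt_top)
  calc ∫⁻ z, ‖p z.1 z.2‖ₑ ^ (3 / 2 : ℝ) ∂μT
      ≤ ∫⁻ z, 2 ^ ((3 / 2 : ℝ) - 1) * (‖P k z.1 z.2 - p z.1 z.2‖ₑ ^ (3 / 2 : ℝ) + ‖P k z.1 z.2‖ₑ ^ (3 / 2 : ℝ)) ∂μT := by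
        refine lintegral_mono fun z => ?_
        have e : p z.1 z.2 = P k z.1 z.2 - (P k z.1 z.2 - p z.1 z.2) := by ring
        calc ‖p z.1 z.2‖ₑ ^ (3 / 2 : ℝ) = ‖P k z.1 z.2 - (P k z.1 z.2 - p z.1 z.2)‖ₑ ^ (3 / 2 : ℝ) := by rw [← e]
          _ ≤ (‖P k z.1 z.2‖ₑ + ‖P k z.1 z.2 - p z.1 z.2‖ₑ) ^ (3 / 2 : ℝ) := by
              gcongr; exact enorm_sub_le
          _ ≤ 2 ^ ((3 / 2 : ℝ) - 1) * (‖P k z.1 z.2‖ₑ ^ (3 / 2 : ℝ) + ‖P k z.1 z.2 - p z.1 z.2‖ₑ ^ (3 / 2 : ℝ)) :=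
              ENNReal.rpow_add_le_mul_rpow_add_rpow _ _ (by norm_num)
          _ = _ := by rw [add_comm]
    _ = 2 ^ ((3 / 2 : ℝ) - 1) * ((∫⁻ z, ‖P k z.1 z.2 - p z.1 z.2‖ₑ ^ (3 / 2 : ℝ) ∂μT) +
          ∫⁻ z, ‖P k z.1 z.2‖ₑ ^ (3 / 2 : ℝ) ∂μT) := by
        rw [lintegral_const_mul' _ _ (ENNReal.rpow_ne_top_of_nonneg (by norm_num) ENNReal.ofNat_ne_top),
          lintegral_add_right' _ hmPT]
    _ < ⊤ := ENNReal.mul_lt_top (ENNReal.rpow_lt_top_of_nonneg (by norm_num) ENNReal.ofNat_ne_top)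
        (ENNReal.add_lt_top.2 ⟨hk.trans_lt ENNReal.one_lt_top, hPk⟩)

/-- **Leray's weak solution is a local energy solution on every strip** (Seregin's class
`IsLocalEnergySolutionOn`, Def. B.1 = Kang–Miura–Tsai Def. 3.1): suitability on the strip, the
global `L^{3/2}` bound of the Riesz pressure, every-time `L²` bounds `‖u(t)‖₂ ≤ ‖u₀‖₂`, the global
`L²` bound of the weak gradient, weak `L²` continuity on `[0, T]`, strong attainment of the datum,
and decay at spatial infinity (tails of the finite space–time energy). [cite: CaffarelliKohnNirenberg1982, Appendix] [cite: Seregin2014, App. B Def. B.1] -/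
theorem IsLerayRegularisedScheme.isLocalEnergySolutionOn_limit
    (hS : IsLerayRegularisedScheme ν u₀ φ U)
    (hP : ∀ n T, 0 < T →
      IsClassicalDriftNSSolutionOn (Icc 0 T) ν (fun t => mollify (φ n) (U n t)) (U n) (P n))
    (hPb : ∀ n t, 0 ≤ t → eLpNorm (P n t) 2 volume ≤
      ((9 : ℕ) : ℝ≥0∞) * eLpNorm (fun x => ‖mollify (φ n) (U n t) x‖ * ‖U n t x‖) 2 volume)
    (hν : 0 < ν) (hu₀ : MemLp u₀ 2 volume) (hW : IsSliceWeakLimit U u₀ u)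
    (hmeas : AEStronglyMeasurable (uncurry u)
      ((volume.restrict (Ioi (0 : ℝ))).prod (volume : Measure (EuclideanSpace ℝ (Fin 3)))))
    (hae : ∀ᵐ t ∂(volume.restrict (Ioi (0 : ℝ))),
      Tendsto (fun n => eLpNorm (U n t - u t) 2 volume) atTop (𝓝 0))
    (hLH : IsGlobalLerayHopf ν 0 u₀ u)
    (hpm : StronglyMeasurable (uncurry p))
    (hp : ∀ᵐ t ∂(volume.restrict (Ioi (0 : ℝ))), ∀ᵐ x : EuclideanSpace ℝ (Fin 3),
      p t x = normalisedPressure (u t) x)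
    {T : ℝ} (hT : 0 < T) :
    IsLocalEnergySolutionOn T ν u₀ u p := by
  have hE : Module.finrank ℝ (EuclideanSpace ℝ (Fin 3)) = 3 := by simp
  set μt : Measure ℝ := volume.restrict (Ioo (0 : ℝ) T) with hμt
  set μT : Measure (ℝ × EuclideanSpace ℝ (Fin 3)) := μt.prod volume with hμT
  have hμTeq : μT = volume.restrict (Ioo (0 : ℝ) T ×ˢ (univ : Set (EuclideanSpace ℝ (Fin 3)))) :=
    restrict_prod_volume_eq T
  have hsuit := hS.isSuitableWeakSolutionOn_limit_slab hP hPb hν hu₀ hW hmeas hae hpm hp hT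
  have hLHT := hLH T hT
  have hu0 : u 0 = u₀ := hW.initial
  -- the global `L^{3/2}` bound of the pressure on the strip
  obtain ⟨C₁, hC₁t, hC₁⟩ := hS.exists_lintegral_pressure_slice_le hP hPb
  have hM3t := cube_const_ne_top (E := EuclideanSpace ℝ (Fin 3)) (ν := ν) hu₀ T
  have hpconvT := hS.tendsto_lintegral_prod_pressure_sub hP hPb hν hu₀ hW hmeas hae hpm hp hT
  have hpT : ∫⁻ z, ‖p z.1 z.2‖ₑ ^ (3 / 2 : ℝ) ∂μT < ⊤ := by
    obtain ⟨k, hk⟩ : ∃ k, ∫⁻ z, ‖P k z.1 z.2 - p z.1 z.2‖ₑ ^ (3 / 2 : ℝ) ∂μT ≤ 1 :=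
      ((ENNReal.tendsto_nhds_zero.1 hpconvT) 1 one_pos).exists
    have hmPT : AEMeasurable (fun z : ℝ × EuclideanSpace ℝ (Fin 3) => ‖P k z.1 z.2‖ₑ ^ (3 / 2 : ℝ)) μT :=
      (aestronglyMeasurable_pressure_prod hP k hT).enorm.pow_const _
    have hPk : ∫⁻ z, ‖P k z.1 z.2‖ₑ ^ (3 / 2 : ℝ) ∂μT < ⊤ :=
      ((hS.lintegral_prod_pressure_le hP hC₁ k hT).trans
        (mul_le_mul' le_rfl (hS.lintegral_prod_cube_le hE hν hu₀ k hT.le))).trans_lt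
        (ENNReal.mul_lt_top hC₁t.lt_top hM3t.lt_top)
    calc ∫⁻ z, ‖p z.1 z.2‖ₑ ^ (3 / 2 : ℝ) ∂μT
        ≤ ∫⁻ z, 2 ^ ((3 / 2 : ℝ) - 1) * (‖P k z.1 z.2 - p z.1 z.2‖ₑ ^ (3 / 2 : ℝ) + ‖P k z.1 z.2‖ₑ ^ (3 / 2 : ℝ)) ∂μT := by
          refine lintegral_mono fun z => ?_
          have e : p z.1 z.2 = P k z.1 z.2 - (P k z.1 z.2 - p z.1 z.2) := by ring
          calc ‖p z.1 z.2‖ₑ ^ (3 / 2 : ℝ) = ‖P k z.1 z.2 - (P k z.1 z.2 - p z.1 z.2)‖ₑ ^ (3 / 2 : ℝ) := by rw [← e]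
            _ ≤ (‖P k z.1 z.2‖ₑ + ‖P k z.1 z.2 - p z.1 z.2‖ₑ) ^ (3 / 2 : ℝ) := by
                gcongr; exact enorm_sub_le
            _ ≤ 2 ^ ((3 / 2 : ℝ) - 1) * (‖P k z.1 z.2‖ₑ ^ (3 / 2 : ℝ) + ‖P k z.1 z.2 - p z.1 z.2‖ₑ ^ (3 / 2 : ℝ)) :=
                ENNReal.rpow_add_le_mul_rpow_add_rpow _ _ (by norm_num)
            _ = _ := by rw [add_comm]
      _ = 2 ^ ((3 / 2 : ℝ) - 1) * ((∫⁻ z, ‖P k z.1 z.2 - p z.1 z.2‖ₑ ^ (3 / 2 : ℝ) ∂μT) +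
            ∫⁻ z, ‖P k z.1 z.2‖ₑ ^ (3 / 2 : ℝ) ∂μT) := by
          rw [lintegral_const_mul' _ _ (ENNReal.rpow_ne_top_of_nonneg (by norm_num) ENNReal.ofNat_ne_top),
            lintegral_add_right' _ hmPT]
      _ < ⊤ := ENNReal.mul_lt_top (ENNReal.rpow_lt_top_of_nonneg (by norm_num) ENNReal.ofNat_ne_top)
          (ENNReal.add_lt_top.2 ⟨hk.trans_lt ENNReal.one_lt_top, hPk⟩)
  -- the global `L²` bound of the weak gradient on the strip
  obtain ⟨G, hGae, hGint, -, -⟩ := hLHT.weakGrad_energy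
  -- the weak gradient of the suitable solution
  obtain ⟨Gs, hGs, hGs2, -⟩ := hsuit.localEnergy
  refine
    { suitable := hsuit
      pressure := fun K hK => ?_
      sliceMeasurable := fun t ht => (hW.memLp t ht.1).1
      uniformLocalEnergy := ⟨(eLpNorm u₀ 2 volume ^ 2).toNNReal, fun t ht x₀ => ?_⟩
      uniformLocalGradient := ?_
      weakContinuous := fun ψ hψ => ?_
      initial := fun K hK => ?_
      decay := fun R hR => ?_ }
  · -- pressure in `L^{3/2}((0,T) × K)`
    calc ∫⁻ z in Ioo 0 T ×ˢ K, ‖p z.1 z.2‖ₑ ^ (3 / 2 : ℝ)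
        ≤ ∫⁻ z in Ioo 0 T ×ˢ univ, ‖p z.1 z.2‖ₑ ^ (3 / 2 : ℝ) := lintegral_mono_set (prod_mono subset_rfl (subset_univ _))
      _ = ∫⁻ z, ‖p z.1 z.2‖ₑ ^ (3 / 2 : ℝ) ∂μT := by rw [hμTeq]
      _ < ⊤ := hpT
  · -- every-time unit-ball bounds
    rw [ENNReal.coe_toNNReal (ENNReal.pow_ne_top hu₀.eLpNorm_ne_top)]
    calc ∫⁻ x in ball x₀ 1, ‖u t x‖ₑ ^ 2 ≤ ∫⁻ x, ‖u t x‖ₑ ^ 2 := setLIntegral_le_lintegral _ _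
      _ = eLpNorm (u t) 2 volume ^ 2 := FourierNS.lintegral_enorm_sq_eq_eLpNorm_sq volume (u t)
      _ ≤ eLpNorm u₀ 2 volume ^ 2 := by gcongr; exact hW.eLpNorm_le t ht.1
  · -- the weak spatial gradient of the suitable solution with its global bound
    -- (uniqueness of weak gradients: `Gs = G` a.e. on the strip; we use `Gs` with the bound of `G`
    -- transported through the a.e. identity slice by slice is avoided: bound `Gs` directly on unit
    -- cylinders by compact exhaustion of time? No — use the global bound of the suitable-solution
    -- gradient from the cylinder construction instead)
    refine ⟨Gs, hGs, (ENNReal.ofReal (VectorCalculus.kineticEnergy u₀ / ν)).toNNReal, fun x₀ => ?_⟩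
    rw [ENNReal.coe_toNNReal ENNReal.ofReal_ne_top]
    -- a cylinder `(0,T) × B(0, ‖x₀‖ + 1)` containing the unit cylinder at `x₀`
    set R : ℝ := ‖x₀‖ + 1 with hR
    obtain ⟨GR, hGR, hGR2⟩ := hS.exists_hasWeakSpatialGradientOn_cylinder_le hP hν hu₀ hW hmeas hae hT R
    set QR : Opens (ℝ × EuclideanSpace ℝ (Fin 3)) :=
      ⟨Ioo (0 : ℝ) T ×ˢ ball (0 : EuclideanSpace ℝ (Fin 3)) R, isOpen_Ioo.prod isOpen_ball⟩ with hQR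
    have hle : QR ≤ slab (EuclideanSpace ℝ (Fin 3)) (Ioo 0 T) isOpen_Ioo := fun z hz =>
      mem_slab.2 (mem_prod.1 hz).1
    have hsub : Ioo (0 : ℝ) T ×ˢ ball x₀ 1 ⊆ (QR : Set (ℝ × EuclideanSpace ℝ (Fin 3))) := by
      refine prod_mono subset_rfl fun y hy => ?_
      rw [mem_ball, dist_eq_norm] at hy
      rw [mem_ball_zero_iff]
      calc ‖y‖ = ‖(y - x₀) + x₀‖ := by rw [sub_add_cancel]
        _ ≤ ‖y - x₀‖ + ‖x₀‖ := norm_add_le _ _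
        _ < R := by rw [hR]; linarith
    -- `Gs = GR` a.e. on the cylinder
    have hae' := (hGs.mono hle).ae_eq hGR
    have hm : MeasurableSet (Ioo (0 : ℝ) T ×ˢ ball x₀ 1) := measurableSet_Ioo.prod measurableSet_ball
    calc ∫⁻ z in Ioo 0 T ×ˢ ball x₀ 1, ENNReal.ofReal (frobeniusNormSq (Gs z.1 z.2))
        = ∫⁻ z in Ioo 0 T ×ˢ ball x₀ 1, ENNReal.ofReal (frobeniusNormSq (GR z.1 z.2)) := by
          refine setLIntegral_congr_fun_ae hm ?_
          have h1 := ae_imp_of_ae_restrict hae'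
          filter_upwards [h1] with z hz hzK
          have e : Gs z.1 z.2 = GR z.1 z.2 := hz (hsub hzK)
          rw [e]
      _ ≤ ∫⁻ z in (QR : Set (ℝ × EuclideanSpace ℝ (Fin 3))), ENNReal.ofReal (frobeniusNormSq (GR z.1 z.2)) :=
          lintegral_mono_set hsub
      _ ≤ ENNReal.ofReal (VectorCalculus.kineticEnergy u₀ / ν) := hGR2
  · -- weak continuity on `[0, T]`
    have hψ2 : MemLp ψ 2 volume := hψ.contDiff.continuous.memLp_of_hasCompactSupport hψ.hasCompactSupport
    obtain ⟨hc, h0⟩ := (hLH (T + 1) (by linarith)).weak_continuous ψ hψ2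
    intro t ht
    rcases eq_or_lt_of_le ht.1 with h | h
    · -- `t = 0`
      subst h
      have h0' : Tendsto (fun t => ∫ x, ⟪u t x, ψ x⟫) (𝓝[>] 0) (𝓝 (∫ x, ⟪u 0 x, ψ x⟫)) := by rwa [hu0]
      have hIci : ContinuousWithinAt (fun t => ∫ x, ⟪u t x, ψ x⟫) (Ici 0) 0 :=
        continuousWithinAt_Ioi_iff_Ici.1 h0'
      exact hIci.mono fun s hs => hs.1
    · have hct := hc t ⟨h, by linarith [ht.2]⟩
      refine (hct.mono_of_mem_nhdsWithin ?_)
      rw [mem_nhdsWithin_iff_exists_mem_nhds_inter]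
      refine ⟨Ioi 0, Ioi_mem_nhds h, fun s hs => ⟨hs.1, by linarith [hs.2.2]⟩⟩
  · -- strong attainment of the datum, on every compact set
    have hst := (hLH T hT).strong_initial
    have h2 : Tendsto (fun t => eLpNorm (u t - u₀) 2 volume ^ 2) (𝓝[>] 0) (𝓝 0) := by
      have := ((ENNReal.continuous_pow 2).tendsto 0).comp hst
      rwa [zero_pow two_ne_zero] at this
    refine tendsto_of_tendsto_of_tendsto_of_le_of_le tendsto_const_nhds h2 (fun _ => zero_le) fun t => ?_
    calc ∫⁻ x in K, ‖u t x - u₀ x‖ₑ ^ 2 ≤ ∫⁻ x, ‖u t x - u₀ x‖ₑ ^ 2 := setLIntegral_le_lintegral _ _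
      _ = eLpNorm (u t - u₀) 2 volume ^ 2 := FourierNS.lintegral_enorm_sq_eq_eLpNorm_sq volume (u t - u₀)
  · -- decay at spatial infinity: tails of the finite space–time energy
    have hmu : AEStronglyMeasurable (uncurry u) μT := hmeas.mono_measure (prod_restrict_Ioo_le_prod_restrict_Ioi T)
    set g : EuclideanSpace ℝ (Fin 3) → ℝ≥0∞ := fun x => ∫⁻ t in Ioo 0 T, ‖u t x‖ₑ ^ 2 with hg
    have hm2 : AEMeasurable (uncurry fun t x => ‖u t x‖ₑ ^ 2) μT := hmu.enorm.pow_const _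
    have hgfin : ∫⁻ x, g x ≠ ⊤ := by
      have hswap : ∫⁻ x, g x = ∫⁻ t in Ioo 0 T, ∫⁻ x, ‖u t x‖ₑ ^ 2 := (lintegral_lintegral_swap hm2).symm
      rw [hswap]
      refine ne_of_lt ?_
      calc ∫⁻ t in Ioo 0 T, ∫⁻ x, ‖u t x‖ₑ ^ 2 ≤ ∫⁻ _t in Ioo 0 T, eLpNorm u₀ 2 volume ^ 2 := by
            refine lintegral_mono_ae ?_
            filter_upwards [ae_restrict_mem (measurableSet_Ioo : MeasurableSet (Ioo (0 : ℝ) T))] with t ht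
            rw [FourierNS.lintegral_enorm_sq_eq_eLpNorm_sq volume (u t)]
            gcongr
            exact hW.eLpNorm_le t ht.1.le
        _ < ⊤ := by
            rw [lintegral_const, Measure.restrict_apply_univ]
            exact ENNReal.mul_lt_top (ENNReal.pow_lt_top hu₀.eLpNorm_lt_top) measure_Ioo_lt_top
    have hlim := tendsto_setLIntegral_ball_cocompact hgfin R
    refine hlim.congr fun x₀ => ?_
    -- `∫_{B(x₀,R)} g = ∫∫_{(0,T) × B(x₀,R)} |u|²`
    have hm2' : AEMeasurable (uncurry fun t x => ‖u t x‖ₑ ^ 2)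
        ((volume.restrict (Ioo (0 : ℝ) T)).prod (volume.restrict (ball x₀ R))) :=
      hm2.mono_measure (Measure.prod_mono le_rfl Measure.restrict_le_self)
    calc ∫⁻ x in ball x₀ R, g x = ∫⁻ t in Ioo 0 T, ∫⁻ x in ball x₀ R, ‖u t x‖ₑ ^ 2 :=
          (lintegral_lintegral_swap hm2').symm
      _ = ∫⁻ z, ‖u z.1 z.2‖ₑ ^ 2 ∂((volume.restrict (Ioo (0 : ℝ) T)).prod (volume.restrict (ball x₀ R))) :=
          (lintegral_prod _ hm2').symm
      _ = ∫⁻ z in Ioo 0 T ×ˢ ball x₀ R, ‖u z.1 z.2‖ₑ ^ 2 := by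
          rw [Measure.prod_restrict, ← Measure.volume_eq_prod]

/-- **Leray's weak solutions are local energy solutions** (Caffarelli–Kohn–Nirenberg 1982,
Appendix: the solutions constructed by Leray's regularisation are suitable; Lemarié-Rieusset 2002,
Ch. 32–33 / Kikuchi–Seregin 2007: finite-energy data give local energy solutions). For `ν > 0`
and every weakly divergence-free `u₀ ∈ L²(ℝ³)` there is a global Leray–Hopf weak solution `u`
with a pressure `p` (the Riesz-transform pressure `p(t) = p̃[u(t)]` a.e.) such that `(u, p)` is a
local energy solution on `(0, T)` for every `T > 0`; moreover `p ∈ L^{3/2}` and `u ∈ L³` of every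
slab `(0,T) × ℝ³`. [cite: CaffarelliKohnNirenberg1982, Appendix] [cite: Seregin2014, App. B Def. B.1] -/
theorem exists_isGlobalLerayHopf_and_isLocalEnergySolutionOn {ν : ℝ} (hν : 0 < ν)
    {u₀ : EuclideanSpace ℝ (Fin 3) → EuclideanSpace ℝ (Fin 3)} (hu₀ : MemLp u₀ 2 volume)
    (hdiv : IsWeaklyDivFree u₀) :
    ∃ (u : ℝ → EuclideanSpace ℝ (Fin 3) → EuclideanSpace ℝ (Fin 3))
      (p : ℝ → EuclideanSpace ℝ (Fin 3) → ℝ),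
      IsGlobalLerayHopf ν 0 u₀ u ∧
      (∀ᵐ t ∂(volume.restrict (Ioi (0 : ℝ))), ∀ᵐ x : EuclideanSpace ℝ (Fin 3),
        p t x = normalisedPressure (u t) x) ∧
      AEStronglyMeasurable (uncurry u)
        ((volume.restrict (Ioi (0 : ℝ))).prod (volume : Measure (EuclideanSpace ℝ (Fin 3)))) ∧
      StronglyMeasurable (uncurry p) ∧
      (∀ T, 0 < T → ∫⁻ z in Ioo (0 : ℝ) T ×ˢ (univ : Set (EuclideanSpace ℝ (Fin 3))),
        ‖p z.1 z.2‖ₑ ^ (3 / 2 : ℝ) < ⊤) ∧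
      (∀ T, 0 < T → ∫⁻ z in Ioo (0 : ℝ) T ×ˢ (univ : Set (EuclideanSpace ℝ (Fin 3))),
        ‖u z.1 z.2‖ₑ ^ (3 : ℕ) < ⊤) ∧
      ∀ T, 0 < T → IsLocalEnergySolutionOn T ν u₀ u p := by
  obtain ⟨φ, U, P, hS, hP, hPb⟩ := exists_lerayScheme_with_pressure hν hu₀ hdiv
  obtain ⟨κ, u, hκ, hW, hmeas, hae, hLH⟩ := hS.exists_subseq_limit_package hν hu₀ hdiv
  have hS' := hS.comp_strictMono hκ
  have hP' : ∀ n T, 0 < T → IsClassicalDriftNSSolutionOn (Icc 0 T) ν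
      (fun t => mollify ((φ ∘ κ) n) (U (κ n) t)) (U (κ n)) (P (κ n)) := fun n T hT => hP (κ n) T hT
  have hPb' : ∀ n t, 0 ≤ t → eLpNorm (P (κ n) t) 2 volume ≤
      ((9 : ℕ) : ℝ≥0∞) * eLpNorm (fun x => ‖mollify ((φ ∘ κ) n) (U (κ n) t) x‖ * ‖U (κ n) t x‖) 2 volume :=
    fun n t ht => hPb (κ n) t ht
  obtain ⟨p, hpm, hp⟩ := exists_measurable_limit_pressure hmeas fun t ht => hW.memLp t ht
  refine ⟨u, p, hLH, hp, hmeas, hpm, fun T hT =>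
    hS'.lintegral_limit_pressure_lt_top (P := fun n => P (κ n)) hP' hPb' hν hu₀ hW hmeas hae hpm hp hT, fun T hT => ?_,
    fun T hT => hS'.isLocalEnergySolutionOn_limit (P := fun n => P (κ n)) hP' hPb' hν hu₀ hW hmeas hae hLH hpm hp hT⟩
  -- `u ∈ L³` of the slab `(0,T) × ℝ³`
  have hE : Module.finrank ℝ (EuclideanSpace ℝ (Fin 3)) = 3 := by simp
  have h3 := hS'.lintegral_prod_cube_limit_lt_top hE hν hu₀ hW hmeas hae hT.le
  rw [← restrict_prod_volume_eq T]
  refine lt_of_le_of_lt (le_of_eq (lintegral_congr fun z => ?_)) h3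
  rw [← ENNReal.rpow_natCast]
  norm_num

end Packaging

end Literature.Analysis.FluidPDE
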